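import Literature.Barriers.AtomisticToContinuum.DisorderedHarmonicChainDensityUpperEstimates
import HarnessLib

/-!
# Ajanki–Huveneers 2011, towards the lower bound (5.2) of Prop. 5.1: the low-frequency CLT for `X_n`

For the critical-band chain `X^x_n` of O. Ajanki, F. Huveneers, CMP **301** (2011) 841–883
(arXiv:1003.1076), §3 and §5, with NO tilt (`h ≡ 0`), we PROVE a quantitative central limit theorem
at bounded frequencies, uniformly in the start:
`|𝔼 cos θX^x_n - e^{-θ²V_n/2} cos θ(x + nϑ)| ≤ C w`, `|𝔼 sin θX^x_n - e^{-θ²V_n/2} sin θ(x + nϑ)| ≤ C w`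
for `|θ| ≤ Θ`, `w²n ≤ 1`, with the deterministic variance `V_n = (3/8)σ²w²n`, `σ² = ∫ b²τ`
(`clt_low_frequency`). Route (the paper's App. 7.3 computes the same Gaussian limit by Fourier
analysis of the approximate kernels; we argue directly on the chain): by the expansion (3.11),
`X_n = x + nϑ + M_n + D_n + 𝒪(w³n)` with the martingale `M_n = ∑ m̃(X_l, B_l)`,
`m̃(y,b) = wb sin²πy + w²(b² - σ²)(π/2) sin²πy sin 2πy`, and the drift
`D_n = w²σ²(π/2)∑ sin²πX_l sin 2πX_l`; an exponential-martingale argument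
(`e^{θ²⟨M⟩_l/2} cos θM_l`, `e^{θ²⟨M⟩_l/2} sin θM_l` change by `𝒪(w³)` in mean at each step) gives
`𝔼 e^{iθM_n} ≈ e^{-θ²V_n/2}` once `⟨M⟩_n - V_n = 𝒪_{L²}(w)`, and the latter, as well as
`D_n = 𝒪_{L²}(w)`, follow from a pathwise Riemann-sum lemma along the orbit (`w∑ g(X_l)` against
the primitive of `g`) plus the `L²`-orthogonality of `∑ c_l B_l` (`…Martingale.lean`).

[cite: AjankiHuveneers2011, Lemma 3.2 eq. (3.11), Cor. 3.4 (i), App. 7.3 (the Gaussian limit of the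
kernel); folklore (martingale CLT)]
-/

noncomputable section

open Real MeasureTheory Set Filter Function Finset
open scoped ENNReal

namespace Literature.Barriers.AtomisticToContinuum.HeatConduction

/-! ### Elementary inequalities -/

/-- `|e^u (1 - u) - 1| ≤ u²` for `0 ≤ u ≤ 1`. [folklore] -/
theorem abs_exp_mul_one_sub_sub_one_le {u : ℝ} (h1 : u ≤ 1) :
    |Real.exp u * (1 - u) - 1| ≤ u ^ 2 := by
  rw [abs_le]
  constructor
  · have := Real.add_one_le_exp u
    nlinarith [mul_le_mul_of_nonneg_right this (by linarith : (0:ℝ) ≤ 1 - u)]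
  · have h2 : Real.exp u * (1 - u) ≤ 1 := by
      have h3 := Real.add_one_le_exp (-u)
      have h4 : Real.exp u * Real.exp (-u) = 1 := by rw [← Real.exp_add, add_neg_cancel, Real.exp_zero]
      nlinarith [Real.exp_pos u]
    nlinarith

/-- `|y| ≤ (1 + y²)/2`. [folklore] -/
theorem abs_le_half_one_add_sq (y : ℝ) : |y| ≤ (1 + y ^ 2) / 2 := by
  rcases abs_choice y with h | h <;> rw [h] <;> nlinarith [sq_nonneg (y - 1), sq_nonneg (y + 1)]

/-- Lipschitz bound from a bounded derivative (`HasDerivAt` version, whole line). [folklore] -/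
theorem abs_sub_le_of_hasDerivAt {f f' : ℝ → ℝ} (hf : ∀ y, HasDerivAt f (f' y) y) {C : ℝ}
    (hC : ∀ y, |f' y| ≤ C) (y y' : ℝ) : |f y - f y'| ≤ C * |y - y'| := by
  have := convex_univ.norm_image_sub_le_of_norm_hasDerivWithin_le (f := f) (f' := f') (C := C)
    (fun z _ => (hf z).hasDerivWithinAt) (fun z _ => by rw [Real.norm_eq_abs]; exact hC z)
    (Set.mem_univ y') (Set.mem_univ y)
  simpa [Real.norm_eq_abs] using this

/-- `|e^{-a} - e^{-b}| ≤ |a - b|` for `a, b ≥ 0`. [folklore] -/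
theorem abs_exp_neg_sub_exp_neg_le {a b : ℝ} (ha : 0 ≤ a) (hb : 0 ≤ b) :
    |Real.exp (-a) - Real.exp (-b)| ≤ |a - b| := by
  have key : ∀ a b : ℝ, 0 ≤ a → a ≤ b → Real.exp (-b) ≥ Real.exp (-a) - (b - a) := by
    intro a b ha hab
    have h1 := Real.add_one_le_exp (-(b - a))
    have h2 : Real.exp (-b) = Real.exp (-a) * Real.exp (-(b - a)) := by rw [← Real.exp_add]; ring_nf
    have h3 : Real.exp (-a) ≤ 1 := by rw [Real.exp_le_one_iff]; linarith
    have h4 : 0 ≤ b - a := by linarith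
    rw [h2]
    nlinarith [Real.exp_pos (-a), Real.exp_pos (-(b - a))]
  rcases le_total a b with hab | hab
  · have h1 := key a b ha hab
    have h2 : Real.exp (-b) ≤ Real.exp (-a) := Real.exp_le_exp.mpr (by linarith)
    rw [abs_of_nonneg (by linarith), abs_of_nonpos (by linarith)]
    linarith
  · have h1 := key b a hb hab
    have h2 : Real.exp (-a) ≤ Real.exp (-b) := Real.exp_le_exp.mpr (by linarith)
    rw [abs_of_nonpos (by linarith), abs_of_nonneg (by linarith)]
    linarith

/-- **Riemann sums along a monotone orbit**: if `P' = g` with `g` `L`-Lipschitz and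
`0 ≤ X_{l+1} - X_l ≤ Δ`, then `|∑_{l<N} g(X_l)(X_{l+1} - X_l) - (P(X_N) - P(X_0))| ≤ L N Δ²`.
[folklore] -/
theorem abs_sum_mul_sub_sub_le {g P : ℝ → ℝ} (hP : ∀ y, HasDerivAt P (g y) y) {L : ℝ}
    (hg : ∀ y y', |g y - g y'| ≤ L * |y - y'|) (X : ℕ → ℝ) (N : ℕ) {Δ : ℝ}
    (hΔ : ∀ l, l < N → 0 ≤ X (l + 1) - X l ∧ X (l + 1) - X l ≤ Δ) :
    |∑ l ∈ Finset.range N, g (X l) * (X (l + 1) - X l) - (P (X N) - P (X 0))| ≤ L * N * Δ ^ 2 := by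
  have hL : 0 ≤ L := by
    have := hg 1 0
    by_contra h
    push Not at h
    have : |g 1 - g 0| < 0 := by
      calc |g 1 - g 0| ≤ L * |1 - 0| := this
        _ < 0 := by norm_num; exact h
    exact absurd this (not_lt.mpr (abs_nonneg _))
  -- one step
  have hstep : ∀ l, l < N → |g (X l) * (X (l + 1) - X l) - (P (X (l + 1)) - P (X l))| ≤ L * Δ ^ 2 := by
    intro l hl
    obtain ⟨h0, h1⟩ := hΔ l hl
    rcases h0.lt_or_eq with hlt | heq
    · have hab : X l < X (l + 1) := by linarith
      obtain ⟨c, hc, hcd⟩ := exists_hasDerivAt_eq_slope P g hab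
        (fun y _ => (hP y).continuousAt.continuousWithinAt) (fun y _ => hP y)
      have hPc : P (X (l + 1)) - P (X l) = g c * (X (l + 1) - X l) := by
        rw [hcd, div_mul_cancel₀ _ (ne_of_gt hlt)]
      rw [hPc, ← sub_mul, abs_mul, abs_of_nonneg h0]
      have hgc : |g (X l) - g c| ≤ L * Δ := by
        refine (hg _ _).trans (mul_le_mul_of_nonneg_left ?_ hL)
        rw [abs_le]; constructor <;> linarith [hc.1, hc.2]
      calc |g (X l) - g c| * (X (l + 1) - X l) ≤ L * Δ * Δ :=
            mul_le_mul hgc h1 h0 (mul_nonneg hL (h0.trans h1))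
        _ = L * Δ ^ 2 := by ring
    · have hx : X (l + 1) = X l := by linarith
      rw [hx, sub_self, mul_zero, sub_self, sub_zero, abs_zero]
      exact mul_nonneg hL (sq_nonneg _)
  -- sum
  have htel : ∑ l ∈ Finset.range N, (P (X (l + 1)) - P (X l)) = P (X N) - P (X 0) :=
    Finset.sum_range_sub (fun l => P (X l)) N
  rw [← htel, ← Finset.sum_sub_distrib]
  calc |∑ l ∈ Finset.range N, (g (X l) * (X (l + 1) - X l) - (P (X (l + 1)) - P (X l)))|
      ≤ ∑ l ∈ Finset.range N, |g (X l) * (X (l + 1) - X l) - (P (X (l + 1)) - P (X l))| :=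
        Finset.abs_sum_le_sum_abs _ _
    _ ≤ ∑ _l ∈ Finset.range N, L * Δ ^ 2 := Finset.sum_le_sum fun l hl => hstep l (Finset.mem_range.mp hl)
    _ = L * N * Δ ^ 2 := by rw [Finset.sum_const, Finset.card_range, nsmul_eq_mul]; ring

/-! ### The explicit trigonometric functions of the expansion (3.11) -/

/-- `s(y) = sin² πy`. [cite: AjankiHuveneers2011, Lemma 3.2 eq. (3.11)] -/
def clS (y : ℝ) : ℝ := Real.sin (π * y) ^ 2

/-- `h₂(y) = sin² πy · sin 2πy`. [cite: AjankiHuveneers2011, Lemma 3.2 eq. (3.11)] -/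
def clH (y : ℝ) : ℝ := Real.sin (π * y) ^ 2 * Real.sin (2 * π * y)

/-- `s` is continuous (compositional form for `fun_prop`). [folklore] -/
@[fun_prop]
theorem continuous_clS_comp {α : Type*} [TopologicalSpace α] {f : α → ℝ} (hf : Continuous f) :
    Continuous fun a => clS (f a) := by unfold clS; fun_prop

/-- `h₂` is continuous (compositional form for `fun_prop`). [folklore] -/
@[fun_prop]
theorem continuous_clH_comp {α : Type*} [TopologicalSpace α] {f : α → ℝ} (hf : Continuous f) :
    Continuous fun a => clH (f a) := by unfold clH; fun_prop

/-- `0 ≤ s ≤ 1`. [folklore] -/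
theorem clS_mem (y : ℝ) : 0 ≤ clS y ∧ clS y ≤ 1 :=
  ⟨sq_nonneg _, by unfold clS; rw [sq_le_one_iff_abs_le_one]; exact Real.abs_sin_le_one _⟩

/-- `|h₂| ≤ 1`. [folklore] -/
theorem abs_clH_le (y : ℝ) : |clH y| ≤ 1 := by
  unfold clH
  rw [abs_mul, abs_of_nonneg (sq_nonneg _)]
  have h1 := (clS_mem y).2
  unfold clS at h1
  exact mul_le_one₀ h1 (abs_nonneg _) (Real.abs_sin_le_one _)

/-- `sin⁴ πy = 3/8 - cos 2πy/2 + cos 4πy/8`. [folklore] -/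
theorem sin_pow_four_eq (y : ℝ) :
    Real.sin (π * y) ^ 4 = 3 / 8 - Real.cos (2 * π * y) / 2 + Real.cos (4 * π * y) / 8 := by
  have h1 : Real.sin (π * y) ^ 2 = (1 - Real.cos (2 * π * y)) / 2 := by
    rw [show 2 * π * y = 2 * (π * y) by ring, Real.cos_two_mul, Real.cos_sq']; ring
  have h2 : Real.cos (2 * π * y) ^ 2 = (1 + Real.cos (4 * π * y)) / 2 := by
    rw [show 4 * π * y = 2 * (2 * π * y) by ring, Real.cos_two_mul]; ring
  calc Real.sin (π * y) ^ 4 = (Real.sin (π * y) ^ 2) ^ 2 := by ring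
    _ = ((1 - Real.cos (2 * π * y)) / 2) ^ 2 := by rw [h1]
    _ = (1 - 2 * Real.cos (2 * π * y) + Real.cos (2 * π * y) ^ 2) / 4 := by ring
    _ = 3 / 8 - Real.cos (2 * π * y) / 2 + Real.cos (4 * π * y) / 8 := by rw [h2]; ring

/-- `h₂ = sin 2πy/2 - sin 4πy/4`. [folklore] -/
theorem clH_eq (y : ℝ) : clH y = Real.sin (2 * π * y) / 2 - Real.sin (4 * π * y) / 4 := by
  unfold clH
  have h1 : Real.sin (π * y) ^ 2 = (1 - Real.cos (2 * π * y)) / 2 := by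
    rw [show 2 * π * y = 2 * (π * y) by ring, Real.cos_two_mul, Real.cos_sq']; ring
  have h2 : Real.sin (4 * π * y) = 2 * Real.sin (2 * π * y) * Real.cos (2 * π * y) := by
    rw [show 4 * π * y = 2 * (2 * π * y) by ring, Real.sin_two_mul]
  rw [h1, h2]; ring

/-- The primitive of `s² - 3/8 = sin⁴ π· - 3/8`. [folklore] -/
def clP1 (y : ℝ) : ℝ := -Real.sin (2 * π * y) / (4 * π) + Real.sin (4 * π * y) / (32 * π)

/-- The primitive of `h₂`. [folklore] -/
def clP2 (y : ℝ) : ℝ := -Real.cos (2 * π * y) / (4 * π) + Real.cos (4 * π * y) / (16 * π)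

/-- `(sin cy)' = c cos cy`. [folklore] -/
theorem hasDerivAt_sin_cmul (c y : ℝ) : HasDerivAt (fun y => Real.sin (c * y)) (c * Real.cos (c * y)) y := by
  have h := ((hasDerivAt_id' y).const_mul c).sin
  exact h.congr_deriv (by ring)

/-- `(cos cy)' = -c sin cy`. [folklore] -/
theorem hasDerivAt_cos_cmul (c y : ℝ) : HasDerivAt (fun y => Real.cos (c * y)) (-(c * Real.sin (c * y))) y := by
  have h := ((hasDerivAt_id' y).const_mul c).cos
  exact h.congr_deriv (by ring)

/-- `P₁' = s² - 3/8`. [folklore] -/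
theorem hasDerivAt_clP1 (y : ℝ) : HasDerivAt clP1 (clS y ^ 2 - 3 / 8) y := by
  have h1 := hasDerivAt_sin_cmul (2 * π) y
  have h2 := hasDerivAt_sin_cmul (4 * π) y
  have h : HasDerivAt (fun y => -Real.sin (2 * π * y) / (4 * π) + Real.sin (4 * π * y) / (32 * π))
      (-(2 * π * Real.cos (2 * π * y)) / (4 * π) + 4 * π * Real.cos (4 * π * y) / (32 * π)) y :=
    (h1.neg.div_const _).add (h2.div_const _)
  refine h.congr_deriv ?_
  unfold clS
  rw [show (Real.sin (π * y) ^ 2) ^ 2 = Real.sin (π * y) ^ 4 by ring, sin_pow_four_eq]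
  field_simp; ring

/-- `P₂' = h₂`. [folklore] -/
theorem hasDerivAt_clP2 (y : ℝ) : HasDerivAt clP2 (clH y) y := by
  have h1 := hasDerivAt_cos_cmul (2 * π) y
  have h2 := hasDerivAt_cos_cmul (4 * π) y
  have h : HasDerivAt (fun y => -Real.cos (2 * π * y) / (4 * π) + Real.cos (4 * π * y) / (16 * π))
      (-(-(2 * π * Real.sin (2 * π * y))) / (4 * π) + -(4 * π * Real.sin (4 * π * y)) / (16 * π)) y :=
    (h1.neg.div_const _).add (h2.div_const _)
  refine h.congr_deriv ?_
  rw [clH_eq]; field_simp; ring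

/-- `|P₁| ≤ 1`. [folklore] -/
theorem abs_clP1_le (y : ℝ) : |clP1 y| ≤ 1 := by
  unfold clP1
  have hπ : 3 ≤ π := by linarith [Real.pi_gt_three]
  have h1 : |-Real.sin (2 * π * y) / (4 * π)| ≤ 1 / 2 := by
    rw [abs_div, abs_neg, abs_of_pos (by positivity : (0:ℝ) < 4 * π), div_le_iff₀ (by positivity)]
    nlinarith [Real.abs_sin_le_one (2 * π * y)]
  have h2 : |Real.sin (4 * π * y) / (32 * π)| ≤ 1 / 2 := by
    rw [abs_div, abs_of_pos (by positivity : (0:ℝ) < 32 * π), div_le_iff₀ (by positivity)]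
    nlinarith [Real.abs_sin_le_one (4 * π * y)]
  exact (abs_add_le _ _).trans (by linarith)

/-- `|P₂| ≤ 1`. [folklore] -/
theorem abs_clP2_le (y : ℝ) : |clP2 y| ≤ 1 := by
  unfold clP2
  have hπ : 3 ≤ π := by linarith [Real.pi_gt_three]
  have h1 : |-Real.cos (2 * π * y) / (4 * π)| ≤ 1 / 2 := by
    rw [abs_div, abs_neg, abs_of_pos (by positivity : (0:ℝ) < 4 * π), div_le_iff₀ (by positivity)]
    nlinarith [Real.abs_cos_le_one (2 * π * y)]
  have h2 : |Real.cos (4 * π * y) / (16 * π)| ≤ 1 / 2 := by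
    rw [abs_div, abs_of_pos (by positivity : (0:ℝ) < 16 * π), div_le_iff₀ (by positivity)]
    nlinarith [Real.abs_cos_le_one (4 * π * y)]
  exact (abs_add_le _ _).trans (by linarith)

/-- `s` has derivative `π sin 2πy`. [folklore] -/
theorem hasDerivAt_clS (y : ℝ) : HasDerivAt clS (π * Real.sin (2 * π * y)) y := by
  have h := (hasDerivAt_sin_cmul π y).pow 2
  refine h.congr_deriv ?_
  rw [show 2 * π * y = 2 * (π * y) by ring, Real.sin_two_mul]
  norm_num; ring

/-- `s² - 3/8` is `2π`-Lipschitz. [folklore] -/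
theorem abs_clS_sq_sub_le (y y' : ℝ) : |(clS y ^ 2 - 3 / 8) - (clS y' ^ 2 - 3 / 8)| ≤ 2 * π * |y - y'| := by
  have hd : ∀ z, HasDerivAt (fun z => clS z ^ 2 - 3 / 8) (↑(2:ℕ) * clS z ^ (2 - 1) * (π * Real.sin (2 * π * z))) z :=
    fun z => ((hasDerivAt_clS z).pow 2).sub_const (3 / 8)
  refine abs_sub_le_of_hasDerivAt hd (fun z => ?_) y y'
  have h1 := clS_mem z
  norm_num
  rw [abs_of_nonneg h1.1, abs_of_pos Real.pi_pos]
  have h3 := mul_le_mul h1.2 (Real.abs_sin_le_one (2 * π * z)) (abs_nonneg _) zero_le_one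
  nlinarith [Real.pi_pos, h3]

/-- `h₂` is `3π`-Lipschitz. [folklore] -/
theorem abs_clH_sub_le (y y' : ℝ) : |clH y - clH y'| ≤ 3 * π * |y - y'| := by
  have hd : ∀ z, HasDerivAt clH (2 * π * Real.cos (2 * π * z) / 2 - 4 * π * Real.cos (4 * π * z) / 4) z := by
    intro z
    have e : clH = fun z => Real.sin (2 * π * z) / 2 - Real.sin (4 * π * z) / 4 := funext clH_eq
    rw [e]
    exact ((hasDerivAt_sin_cmul (2 * π) z).div_const 2).sub ((hasDerivAt_sin_cmul (4 * π) z).div_const 4)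
  refine abs_sub_le_of_hasDerivAt hd (fun z => ?_) y y'
  have e : 2 * π * Real.cos (2 * π * z) / 2 - 4 * π * Real.cos (4 * π * z) / 4 =
      π * (Real.cos (2 * π * z) - Real.cos (4 * π * z)) := by ring
  rw [e, abs_mul, abs_of_pos Real.pi_pos]
  have h1 := abs_le.mp (Real.abs_cos_le_one (2 * π * z))
  have h2 := abs_le.mp (Real.abs_cos_le_one (4 * π * z))
  have : |Real.cos (2 * π * z) - Real.cos (4 * π * z)| ≤ 3 := by rw [abs_le]; constructor <;> linarith
  nlinarith [Real.pi_pos]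

/-! ### The increments of the expansion (3.11) and the chain constants -/

/-- The centred martingale increment `m̃(y,b) = wb s(y) + w²(b² - σ²)(π/2) h₂(y)`.
[cite: AjankiHuveneers2011, Lemma 3.2 eq. (3.11)] -/
def clInc (w σ2 y b : ℝ) : ℝ := w * b * clS y + w ^ 2 * (b ^ 2 - σ2) * (π / 2) * clH y

/-- The predictable quadratic variation increment `q(y) = ∫ m̃(y,b)² τ(b) db`, in closed form
(`κ₃ = ∫ b(b² - σ²)τ`, `κ₄ = ∫ (b² - σ²)²τ`). [folklore] -/
def clQ (w σ2 κ3 κ4 y : ℝ) : ℝ :=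
  w ^ 2 * σ2 * clS y ^ 2 + w ^ 3 * π * κ3 * (clS y * clH y) + w ^ 4 * (π ^ 2 / 4) * κ4 * clH y ^ 2

/-- `m̃` is continuous (compositional form for `fun_prop`). [folklore] -/
@[fun_prop]
theorem continuous_clInc_comp {α : Type*} [TopologicalSpace α] {f g : α → ℝ} (hf : Continuous f)
    (hg : Continuous g) (w σ2 : ℝ) : Continuous fun a => clInc w σ2 (f a) (g a) := by unfold clInc; fun_prop

/-- `q` is continuous (compositional form for `fun_prop`). [folklore] -/
@[fun_prop]
theorem continuous_clQ_comp {α : Type*} [TopologicalSpace α] {f : α → ℝ} (hf : Continuous f)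
    (w σ2 κ3 κ4 : ℝ) : Continuous fun a => clQ w σ2 κ3 κ4 (f a) := by unfold clQ; fun_prop

/-- `m̃² = w²b²s² + w³π b(b²-σ²) s h₂ + w⁴(π²/4)(b²-σ²)² h₂²`. [folklore] -/
theorem clInc_sq (w σ2 y b : ℝ) : clInc w σ2 y b ^ 2 =
    w ^ 2 * b ^ 2 * clS y ^ 2 + w ^ 3 * π * (b * (b ^ 2 - σ2)) * (clS y * clH y) +
      w ^ 4 * (π ^ 2 / 4) * (b ^ 2 - σ2) ^ 2 * clH y ^ 2 := by
  unfold clInc; ring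

variable {τ : ℝ → ℝ} {bm bp : ℝ}

/-- **The chain constants**: `w₁ ∈ (0, 1]` and `C_Δ, C₂, C₃ ≥ 0` with, for `0 < w ≤ w₁`, all `y`
and `b ∈ [b₋, b₊]`: `0 ≤ f_b(y) - y ≤ C_Δ w`; `|Φ(y,b) - wb s(y)| ≤ C₂ w²`;
`|Φ(y,b) - (wb s(y) + w²b²(π/2)h₂(y))| ≤ C₃ w³`; `|ϑ - w| ≤ w³`.
[cite: AjankiHuveneers2011, Lemma 3.2 eq. (3.11), Cor. 3.4 (i)] -/
theorem chain_consts (hτ : ReducedLawHyp τ bm bp) :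
    ∃ w₁ CΔ C₂ C₃ : ℝ, 0 < w₁ ∧ w₁ ≤ 1 ∧ 0 ≤ CΔ ∧ 0 ≤ C₂ ∧ 0 ≤ C₃ ∧ ∀ w ∈ Set.Ioc 0 w₁,
      |ahTheta w - w| ≤ w ^ 3 ∧ ∀ y : ℝ, ∀ b ∈ Set.Icc bm bp,
        (0 ≤ ahStep w b y - y ∧ ahStep w b y - y ≤ CΔ * w) ∧
        |ahPhi w y b - w * b * clS y| ≤ C₂ * w ^ 2 ∧
        |ahPhi w y b - (w * b * clS y + w ^ 2 * b ^ 2 * (π / 2) * clH y)| ≤ C₃ * w ^ 3 := by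
  set bstar : ℝ := max |bm| |bp| with hbstar
  have hbstar0 : 0 ≤ bstar := le_max_of_le_left (abs_nonneg _)
  obtain ⟨wm, hwm, Cm, hmono⟩ := AjankiHuveneers2011_phaseMonotone_holds bm bp hτ.lo hτ.bm_nonpos hτ.bp_nonneg
  obtain ⟨we, hwe, Ce, hexp⟩ := ahPhi_expansion bm bp
  have hCe0 : 0 ≤ |Ce| := abs_nonneg _
  refine ⟨min (min wm we) (1 / 5), (1 + bp) + |Cm|, bstar ^ 2 * (π / 2) + |Ce| * bstar, |Ce| * bstar,
    by positivity, by
      calc min (min wm we) (1 / 5) ≤ 1 / 5 := min_le_right _ _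
        _ ≤ 1 := by norm_num, by
      have := hτ.bp_nonneg; positivity, by positivity, by positivity, ?_⟩
  intro w hw
  obtain ⟨hw0, hwle⟩ := hw
  have hwm' : w ≤ wm := hwle.trans ((min_le_left _ _).trans (min_le_left _ _))
  have hwe' : w ≤ we := hwle.trans ((min_le_left _ _).trans (min_le_right _ _))
  have hw5 : w ≤ 1 / 5 := hwle.trans (min_le_right _ _)
  have hw1 : w ≤ 1 := by linarith
  refine ⟨?_, fun y b hb => ⟨?_, ?_, ?_⟩⟩
  · have h1 := ahTheta_ge hw0.le (by nlinarith [Real.pi_lt_d2])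
    have h2 := ahTheta_le hw0.le hw5
    rw [abs_le]; constructor <;> nlinarith [pow_pos hw0 3]
  · obtain ⟨h1, -, h3⟩ := hmono w ⟨hw0, hwm'⟩ y b hb
    refine ⟨h1.le, h3.trans ?_⟩
    have : Cm * w ^ 2 ≤ |Cm| * w := by
      calc Cm * w ^ 2 ≤ |Cm| * w ^ 2 := mul_le_mul_of_nonneg_right (le_abs_self _) (sq_nonneg _)
        _ ≤ |Cm| * w := mul_le_mul_of_nonneg_left (by nlinarith) (abs_nonneg _)
    nlinarith
  · have h := hexp w ⟨hw0, hwe'⟩ y b hb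
    have hbB : |b| ≤ bstar := ReducedLawHyp.abs_le_of_mem hb
    have hs := clS_mem y
    have hH := abs_clH_le y
    have e : ahPhi w y b - w * b * clS y =
        (ahPhi w y b - Real.sin (π * y) ^ 2 * (w * b + w ^ 2 * b ^ 2 * (π / 2) * Real.sin (2 * π * y))) +
          w ^ 2 * b ^ 2 * (π / 2) * clH y := by unfold clS clH; ring
    rw [e]
    refine (abs_add_le _ _).trans ?_
    have h1 : |ahPhi w y b - Real.sin (π * y) ^ 2 * (w * b + w ^ 2 * b ^ 2 * (π / 2) * Real.sin (2 * π * y))| ≤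
        |Ce| * bstar * w ^ 2 := by
      refine h.trans ?_
      have hs' : Real.sin (π * y) ^ 2 ≤ 1 := hs.2
      calc Ce * w ^ 3 * |b| * Real.sin (π * y) ^ 2 ≤ |Ce| * w ^ 3 * bstar * 1 := by
            have a1 : Ce * w ^ 3 * |b| * Real.sin (π * y) ^ 2 ≤ |Ce| * w ^ 3 * |b| * Real.sin (π * y) ^ 2 := by
              gcongr; exact le_abs_self _
            have a2 : |Ce| * w ^ 3 * |b| * Real.sin (π * y) ^ 2 ≤ |Ce| * w ^ 3 * bstar * Real.sin (π * y) ^ 2 := by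
              gcongr
            have a3 : |Ce| * w ^ 3 * bstar * Real.sin (π * y) ^ 2 ≤ |Ce| * w ^ 3 * bstar * 1 :=
              mul_le_mul_of_nonneg_left hs' (by positivity)
            linarith
        _ ≤ |Ce| * bstar * w ^ 2 := by
            have : w ^ 3 ≤ w ^ 2 := by nlinarith [pow_pos hw0 2]
            nlinarith [mul_nonneg hCe0 hbstar0]
    have h2 : |w ^ 2 * b ^ 2 * (π / 2) * clH y| ≤ bstar ^ 2 * (π / 2) * w ^ 2 := by
      rw [abs_mul, abs_of_nonneg (by positivity : (0:ℝ) ≤ w ^ 2 * b ^ 2 * (π / 2))]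
      have hb2 : b ^ 2 ≤ bstar ^ 2 := by rw [← sq_abs]; exact pow_le_pow_left₀ (abs_nonneg _) hbB 2
      calc w ^ 2 * b ^ 2 * (π / 2) * |clH y| ≤ w ^ 2 * b ^ 2 * (π / 2) * 1 :=
            mul_le_mul_of_nonneg_left hH (by positivity)
        _ = (w ^ 2 * (π / 2)) * b ^ 2 := by ring
        _ ≤ (w ^ 2 * (π / 2)) * bstar ^ 2 := mul_le_mul_of_nonneg_left hb2 (by positivity)
        _ = bstar ^ 2 * (π / 2) * w ^ 2 := by ring
    calc _ ≤ |Ce| * bstar * w ^ 2 + bstar ^ 2 * (π / 2) * w ^ 2 := add_le_add h1 h2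
      _ = (bstar ^ 2 * (π / 2) + |Ce| * bstar) * w ^ 2 := by ring
  · have h := hexp w ⟨hw0, hwe'⟩ y b hb
    have hbB : |b| ≤ bstar := ReducedLawHyp.abs_le_of_mem hb
    have hs := clS_mem y
    have e : w * b * clS y + w ^ 2 * b ^ 2 * (π / 2) * clH y =
        Real.sin (π * y) ^ 2 * (w * b + w ^ 2 * b ^ 2 * (π / 2) * Real.sin (2 * π * y)) := by unfold clS clH; ring
    rw [e]
    refine h.trans ?_
    have hs' : Real.sin (π * y) ^ 2 ≤ 1 := hs.2
    have a1 : Ce * w ^ 3 * |b| * Real.sin (π * y) ^ 2 ≤ |Ce| * w ^ 3 * |b| * Real.sin (π * y) ^ 2 := by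
      gcongr; exact le_abs_self _
    have a2 : |Ce| * w ^ 3 * |b| * Real.sin (π * y) ^ 2 ≤ |Ce| * w ^ 3 * bstar * Real.sin (π * y) ^ 2 := by gcongr
    have a3 : |Ce| * w ^ 3 * bstar * Real.sin (π * y) ^ 2 ≤ |Ce| * w ^ 3 * bstar * 1 :=
      mul_le_mul_of_nonneg_left hs' (by positivity)
    nlinarith

/-- `X_{l+1} - X_l = ϑ + Φ(X_l, B_l)`. [cite: AjankiHuveneers2011, Def. 3.3 eq. (3.12)] -/
theorem ahPhase_succ_sub (w x : ℝ) (B : ℕ → ℝ) (l : ℕ) :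
    ahPhase w x B (l + 1) - ahPhase w x B l = ahTheta w + ahPhi w (ahPhase w x B l) (B l) := by
  rw [ahPhase_succ]; unfold ahStep; ring

/-- `X_N = x + Nϑ + ∑_{l<N} Φ(X_l, B_l)`. [cite: AjankiHuveneers2011, Def. 3.3 eq. (3.12)] -/
theorem ahPhase_eq_sum (w x : ℝ) (B : ℕ → ℝ) (N : ℕ) :
    ahPhase w x B N = x + N * ahTheta w + ∑ l ∈ Finset.range N, ahPhi w (ahPhase w x B l) (B l) := by
  induction N with
  | zero => simp
  | succ n ih =>
    rw [Finset.sum_range_succ, ahPhase_succ]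
    unfold ahStep
    rw [ih]; push_cast; ring

/-- **The Riemann-sum lemma along the orbit** (pathwise): for `P' = g`, `|g| ≤ 1`, `|P| ≤ 1`, `g`
`L`-Lipschitz, disorder in the support and `0 < w ≤ w₁`,
`|w∑_{l<N} g(X_l) + w∑_{l<N} g(X_l) s(X_l) B_l| ≤ 2 + L N (C_Δ w)² + N (w³ + C₂ w²)`.
The inputs are [cite: AjankiHuveneers2011, Lemma 3.2 eq. (3.11) and Cor. 3.4 (i)]; the lemma is [folklore]. -/
theorem abs_wsum_add_wsum_le {w₁ CΔ C₂ C₃ : ℝ}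
    (hcc : ∀ w ∈ Set.Ioc 0 w₁, |ahTheta w - w| ≤ w ^ 3 ∧ ∀ y : ℝ, ∀ b ∈ Set.Icc bm bp,
      (0 ≤ ahStep w b y - y ∧ ahStep w b y - y ≤ CΔ * w) ∧
      |ahPhi w y b - w * b * clS y| ≤ C₂ * w ^ 2 ∧
      |ahPhi w y b - (w * b * clS y + w ^ 2 * b ^ 2 * (π / 2) * clH y)| ≤ C₃ * w ^ 3)
    {g P : ℝ → ℝ} (hP : ∀ y, HasDerivAt P (g y) y) (hg1 : ∀ y, |g y| ≤ 1) (hP1 : ∀ y, |P y| ≤ 1)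
    {L : ℝ} (hL : ∀ y y', |g y - g y'| ≤ L * |y - y'|)
    {w : ℝ} (hw : w ∈ Set.Ioc 0 w₁) (x : ℝ) {B : ℕ → ℝ} (hB : ∀ k, B k ∈ Set.Icc bm bp) (N : ℕ) :
    |w * ∑ l ∈ Finset.range N, g (ahPhase w x B l) +
        w * ∑ l ∈ Finset.range N, g (ahPhase w x B l) * clS (ahPhase w x B l) * B l| ≤
      2 + L * N * (CΔ * w) ^ 2 + N * (w ^ 3 + C₂ * w ^ 2) := by
  obtain ⟨hθ, hyb⟩ := hcc w hw
  set X : ℕ → ℝ := ahPhase w x B with hX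
  -- Riemann sum against the increments
  have hΔ : ∀ l, l < N → 0 ≤ X (l + 1) - X l ∧ X (l + 1) - X l ≤ CΔ * w := by
    intro l _
    have := (hyb (X l) (B l) (hB l)).1
    simp only [hX, ahPhase_succ]
    exact this
  have hR := abs_sum_mul_sub_sub_le hP hL X N hΔ
  -- the increments against `w`
  have hinc : ∀ l, X (l + 1) - X l - w - w * B l * clS (X l) =
      (ahTheta w - w) + (ahPhi w (X l) (B l) - w * B l * clS (X l)) := by
    intro l
    simp only [hX]
    rw [ahPhase_succ_sub]; ring
  have hdev : ∀ l, |g (X l) * (X (l + 1) - X l) - (w * g (X l) + w * (g (X l) * clS (X l) * B l))| ≤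
      w ^ 3 + C₂ * w ^ 2 := by
    intro l
    have e : g (X l) * (X (l + 1) - X l) - (w * g (X l) + w * (g (X l) * clS (X l) * B l)) =
        g (X l) * ((ahTheta w - w) + (ahPhi w (X l) (B l) - w * B l * clS (X l))) := by
      rw [← hinc l]; ring
    rw [e, abs_mul]
    have h2 := (hyb (X l) (B l) (hB l)).2.1
    calc |g (X l)| * |ahTheta w - w + (ahPhi w (X l) (B l) - w * B l * clS (X l))|
        ≤ 1 * (w ^ 3 + C₂ * w ^ 2) :=
          mul_le_mul (hg1 _) ((abs_add_le _ _).trans (add_le_add hθ h2)) (abs_nonneg _) zero_le_one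
      _ = w ^ 3 + C₂ * w ^ 2 := one_mul _
  have hsumdev : |∑ l ∈ Finset.range N, g (X l) * (X (l + 1) - X l) -
      (w * ∑ l ∈ Finset.range N, g (X l) + w * ∑ l ∈ Finset.range N, g (X l) * clS (X l) * B l)| ≤
      N * (w ^ 3 + C₂ * w ^ 2) := by
    rw [Finset.mul_sum, Finset.mul_sum, ← Finset.sum_add_distrib, ← Finset.sum_sub_distrib]
    calc |∑ l ∈ Finset.range N, (g (X l) * (X (l + 1) - X l) - (w * g (X l) + w * (g (X l) * clS (X l) * B l)))|
        ≤ ∑ l ∈ Finset.range N, |g (X l) * (X (l + 1) - X l) - (w * g (X l) + w * (g (X l) * clS (X l) * B l))| :=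
          Finset.abs_sum_le_sum_abs _ _
      _ ≤ ∑ _l ∈ Finset.range N, (w ^ 3 + C₂ * w ^ 2) := Finset.sum_le_sum fun l _ => hdev l
      _ = N * (w ^ 3 + C₂ * w ^ 2) := by rw [Finset.sum_const, Finset.card_range, nsmul_eq_mul]
  have hPP : |P (X N) - P (X 0)| ≤ 2 := by
    calc |P (X N) - P (X 0)| ≤ |P (X N)| + |P (X 0)| := abs_sub _ _
      _ ≤ 1 + 1 := add_le_add (hP1 _) (hP1 _)
      _ = 2 := by norm_num
  -- combine: `|S| ≤ |T| + |S - T|`, `|T| ≤ |T - (P - P)| + |P - P|`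
  have key := abs_sub_abs_le_abs_sub
    (w * ∑ l ∈ Finset.range N, g (X l) + w * ∑ l ∈ Finset.range N, g (X l) * clS (X l) * B l)
    (∑ l ∈ Finset.range N, g (X l) * (X (l + 1) - X l))
  rw [abs_sub_comm] at key
  have key2 : |∑ l ∈ Finset.range N, g (X l) * (X (l + 1) - X l)| ≤ L * N * (CΔ * w) ^ 2 + 2 := by
    have := abs_sub_abs_le_abs_sub (∑ l ∈ Finset.range N, g (X l) * (X (l + 1) - X l)) (P (X N) - P (X 0))
    linarith
  linarith [hsumdev, key, key2]

/-! ### `L²` control of `w∑ g(X_l)` on the disorder space -/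

/-- The martingale part `w∑_{l<N} g(X_l)s(X_l)B_l` as a predictable transform on `τ^{⊗N}`. [folklore] -/
theorem wsum_eq_sum_univ (w x : ℝ) (g : ℝ → ℝ) {N : ℕ} (B : Fin N → ℝ) :
    w * ∑ l ∈ Finset.range N, g (ahPhase w x (finExt B) l) * clS (ahPhase w x (finExt B) l) * finExt B l =
      ∑ k : Fin N, (w * (g (ahPhase w x (finExt B) k) * clS (ahPhase w x (finExt B) k))) * B k := by
  rw [Finset.mul_sum, ← Fin.sum_univ_eq_sum_range]
  refine Finset.sum_congr rfl fun k _ => ?_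
  rw [finExt_of_lt _ k.isLt]; ring

/-- **`𝔼(w∑_{l<N} g(X_l))² ≤ 2K² + 2σ̂²w²N`** with `K` the pathwise constant of
`abs_wsum_add_wsum_le` and `σ̂² = ∫ b² ρ_B(db)`: the martingale part is `L²`-small by orthogonality.
[folklore] -/
theorem integral_sq_wsum_le (hτ : ReducedLawHyp τ bm bp) {ρB : Measure ℝ} [IsProbabilityMeasure ρB]
    (hρ : ρB = volume.withDensity fun s => ENNReal.ofReal (τ s)) {w₁ CΔ C₂ C₃ : ℝ}
    (hcc : ∀ w ∈ Set.Ioc 0 w₁, |ahTheta w - w| ≤ w ^ 3 ∧ ∀ y : ℝ, ∀ b ∈ Set.Icc bm bp,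
      (0 ≤ ahStep w b y - y ∧ ahStep w b y - y ≤ CΔ * w) ∧
      |ahPhi w y b - w * b * clS y| ≤ C₂ * w ^ 2 ∧
      |ahPhi w y b - (w * b * clS y + w ^ 2 * b ^ 2 * (π / 2) * clH y)| ≤ C₃ * w ^ 3)
    {g P : ℝ → ℝ} (hP : ∀ y, HasDerivAt P (g y) y) (hgc : Continuous g) (hg1 : ∀ y, |g y| ≤ 1)
    (hP1 : ∀ y, |P y| ≤ 1) {L : ℝ} (hL : ∀ y y', |g y - g y'| ≤ L * |y - y'|)
    {w : ℝ} (hw : w ∈ Set.Ioc 0 w₁) (x : ℝ) (N : ℕ) :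
    Integrable (fun B : Fin N → ℝ => (w * ∑ l ∈ Finset.range N, g (ahPhase w x (finExt B) l)) ^ 2)
        (Measure.pi fun _ : Fin N => ρB) ∧
      ∫ B, (w * ∑ l ∈ Finset.range N, g (ahPhase w x (finExt B) l)) ^ 2 ∂(Measure.pi fun _ : Fin N => ρB) ≤
        2 * (2 + L * N * (CΔ * w) ^ 2 + N * (w ^ 3 + C₂ * w ^ 2)) ^ 2 + 2 * (∫ b, b ^ 2 ∂ρB) * (w ^ 2 * N) := by
  have hw0 : 0 < w := hw.1
  set μ := (Measure.pi fun _ : Fin N => ρB) with hμ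
  set K : ℝ := 2 + L * N * (CΔ * w) ^ 2 + N * (w ^ 3 + C₂ * w ^ 2) with hK
  set S : (Fin N → ℝ) → ℝ := fun B => w * ∑ l ∈ Finset.range N, g (ahPhase w x (finExt B) l) with hS
  set c : Fin N → (Fin N → ℝ) → ℝ := fun k B =>
    w * (g (ahPhase w x (finExt B) k) * clS (ahPhase w x (finExt B) k)) with hc
  set Mg : (Fin N → ℝ) → ℝ := fun B => ∑ k : Fin N, c k B * B k with hMg
  set bstar : ℝ := max |bm| |bp| with hbstar
  -- measurability
  have hXm : ∀ k : ℕ, Measurable fun B : Fin N → ℝ => ahPhase w x (finExt B) k := measurable_ahPhase_pi w x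
  have hcS : Continuous clS := by unfold clS; fun_prop
  have hcm : ∀ k, Measurable (c k) := fun k =>
    measurable_const.mul ((hgc.measurable.comp (hXm k)).mul (hcS.measurable.comp (hXm k)))
  have hSm : Measurable S := measurable_const.mul (Finset.measurable_sum _ fun l _ => hgc.measurable.comp (hXm l))
  have hMgm : Measurable Mg := Finset.measurable_sum _ fun k _ => (hcm k).mul (measurable_pi_apply k)
  -- bounds
  have hcb : ∀ k B, |c k B| ≤ w := by
    intro k B
    simp only [hc]
    rw [abs_mul, abs_of_pos hw0, abs_mul]
    have h1 := hg1 (ahPhase w x (finExt B) k)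
    have h2 := clS_mem (ahPhase w x (finExt B) k)
    rw [abs_of_nonneg h2.1]
    calc w * (|g (ahPhase w x (finExt B) ↑k)| * clS (ahPhase w x (finExt B) ↑k)) ≤ w * (1 * 1) := by
          refine mul_le_mul_of_nonneg_left (mul_le_mul h1 h2.2 h2.1 zero_le_one) hw0.le
      _ = w := by ring
  have hSb : ∀ B, |S B| ≤ w * N := by
    intro B
    simp only [hS]
    rw [abs_mul, abs_of_pos hw0]
    refine mul_le_mul_of_nonneg_left ?_ hw0.le
    calc |∑ l ∈ Finset.range N, g (ahPhase w x (finExt B) l)| ≤ ∑ l ∈ Finset.range N, |g (ahPhase w x (finExt B) l)| :=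
          Finset.abs_sum_le_sum_abs _ _
      _ ≤ ∑ _l ∈ Finset.range N, (1 : ℝ) := Finset.sum_le_sum fun l _ => hg1 _
      _ = N := by simp
  have hae := ae_pi_mem_Icc hτ.eq_zero hρ N
  -- a.s.: `|S + Mg| ≤ K`
  have hpath : ∀ᵐ B ∂μ, |S B + Mg B| ≤ K := by
    filter_upwards [hae] with B hB
    have hB' : ∀ k, finExt B k ∈ Set.Icc bm bp := by
      intro k
      by_cases hk : k < N
      · rw [finExt_of_lt _ hk]; exact ⟨(hB _).1, (hB _).2⟩
      · simp only [finExt, hk, ↓reduceDIte]; exact ⟨hτ.bm_nonpos, hτ.bp_nonneg⟩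
    have := abs_wsum_add_wsum_le hcc hP hg1 hP1 hL hw x hB' N
    simp only [hS, hMg, hc]
    rw [← wsum_eq_sum_univ]
    exact this
  -- integrability
  have hS2i : Integrable (fun B => S B ^ 2) μ := by
    refine Integrable.mono' (integrable_const ((w * N) ^ 2)) (hSm.pow_const 2).aestronglyMeasurable
      (ae_of_all _ fun B => ?_)
    rw [Real.norm_eq_abs, abs_pow, sq_abs, ← sq_abs]
    exact pow_le_pow_left₀ (abs_nonneg _) (hSb B) 2
  have hMgb : ∀ᵐ B ∂μ, |Mg B| ≤ N * (w * bstar) := by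
    filter_upwards [hae] with B hB
    simp only [hMg]
    calc |∑ k : Fin N, c k B * B k| ≤ ∑ k : Fin N, |c k B * B k| := Finset.abs_sum_le_sum_abs _ _
      _ ≤ ∑ _k : Fin N, w * bstar := Finset.sum_le_sum fun k _ => by
          rw [abs_mul]
          exact mul_le_mul (hcb k B) (ReducedLawHyp.abs_le_of_mem ⟨(hB k).1, (hB k).2⟩) (abs_nonneg _) hw0.le
      _ = N * (w * bstar) := by simp
  have hMg2i : Integrable (fun B => Mg B ^ 2) μ := by
    refine Integrable.mono' (integrable_const ((N * (w * bstar)) ^ 2)) (hMgm.pow_const 2).aestronglyMeasurable ?_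
    filter_upwards [hMgb] with B hB
    rw [Real.norm_eq_abs, abs_pow, sq_abs, ← sq_abs]
    exact pow_le_pow_left₀ (abs_nonneg _) hB 2
  refine ⟨hS2i, ?_⟩
  -- the martingale bound
  have hpred : ∀ k j : Fin N, k ≤ j → ∀ B b, c k (update B j b) = c k B := by
    intro k j hkj B b
    simp only [hc]
    rw [finExt_update, ahPhase_update_of_le w x _ (show (k : ℕ) ≤ j from hkj)]
  have hg0 : ∫ b, (fun b : ℝ => b) b ∂ρB = 0 := by
    rw [integral_rhoB hτ hρ]; exact hτ.mean_zero
  have hI2 : ∀ k l : Fin N, Integrable (fun B => c k B * c l B * (fun b : ℝ => b) (B k) * (fun b : ℝ => b) (B l)) μ := by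
    intro k l
    refine Integrable.mono' (integrable_const (w * w * bstar * bstar))
      ((((hcm k).mul (hcm l)).mul (measurable_pi_apply k)).mul (measurable_pi_apply l)).aestronglyMeasurable ?_
    filter_upwards [hae] with B hB
    rw [Real.norm_eq_abs, abs_mul, abs_mul, abs_mul]
    have h1 := hcb k B
    have h2 := hcb l B
    have h3 : |B k| ≤ bstar := ReducedLawHyp.abs_le_of_mem ⟨(hB k).1, (hB k).2⟩
    have h4 : |B l| ≤ bstar := ReducedLawHyp.abs_le_of_mem ⟨(hB l).1, (hB l).2⟩
    have := mul_le_mul (mul_le_mul (mul_le_mul h1 h2 (abs_nonneg _) hw0.le) h3 (abs_nonneg _) (by positivity))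
      h4 (abs_nonneg _) (by positivity)
    simpa [mul_assoc] using this
  cases N with
  | zero =>
    simp only [Finset.range_zero, Finset.sum_empty, mul_zero, ne_eq, OfNat.ofNat_ne_zero, not_false_eq_true,
      zero_pow, integral_zero, Nat.cast_zero]
    positivity
  | succ n =>
    have hmart := integral_sq_sum_predictable_le ρB c hpred (fun b : ℝ => b) hg0 (le_refl (∫ b, b ^ 2 ∂ρB)) hI2
      Finset.univ (fun _ => w ^ 2) (fun k _ => by
        calc ∫ B, c k B ^ 2 ∂μ ≤ ∫ _B, w ^ 2 ∂μ := by
              refine integral_mono ?_ (integrable_const _) fun B => ?_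
              · exact Integrable.mono' (integrable_const (w ^ 2)) ((hcm k).pow_const 2).aestronglyMeasurable
                  (ae_of_all _ fun B => by
                    rw [Real.norm_eq_abs, abs_pow, sq_abs, ← sq_abs]
                    exact pow_le_pow_left₀ (abs_nonneg _) (hcb k B) 2)
              · have := hcb k B
                rw [← sq_abs]; exact pow_le_pow_left₀ (abs_nonneg _) this 2
          _ = w ^ 2 := by simp)
    have hMg2 : ∫ B, Mg B ^ 2 ∂μ ≤ (∫ b, b ^ 2 ∂ρB) * (w ^ 2 * (n + 1 : ℕ)) := by
      simp only [hMg]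
      refine hmart.trans (le_of_eq ?_)
      rw [Finset.sum_const, Finset.card_univ, Fintype.card_fin, nsmul_eq_mul]
      ring
    -- `S² ≤ 2K² + 2Mg²` a.s.
    have hdom : ∀ᵐ B ∂μ, S B ^ 2 ≤ 2 * K ^ 2 + 2 * Mg B ^ 2 := by
      filter_upwards [hpath] with B hB
      have h1 : (S B + Mg B) ^ 2 ≤ K ^ 2 := by
        rw [← sq_abs]; exact pow_le_pow_left₀ (abs_nonneg _) hB 2
      nlinarith [sq_nonneg (S B + 2 * Mg B)]
    calc ∫ B, S B ^ 2 ∂μ ≤ ∫ B, (2 * K ^ 2 + 2 * Mg B ^ 2) ∂μ :=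
          integral_mono_ae hS2i ((integrable_const _).add (hMg2i.const_mul 2)) hdom
      _ = 2 * K ^ 2 + 2 * ∫ B, Mg B ^ 2 ∂μ := by
          rw [integral_add (integrable_const _) (hMg2i.const_mul 2), integral_const, integral_const_mul]
          simp
      _ ≤ 2 * K ^ 2 + 2 * ((∫ b, b ^ 2 ∂ρB) * (w ^ 2 * (n + 1 : ℕ))) := by linarith [hMg2]
      _ = 2 * K ^ 2 + 2 * (∫ b, b ^ 2 ∂ρB) * (w ^ 2 * (n + 1 : ℕ)) := by ring

/-! ### One-step trigonometric moments of the increment -/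

/-- `ρ_B`-a.e. the reduced mass lies in `[b₋, b₊]`. [folklore] -/
theorem ae_mem_Icc_rhoB (hτ : ReducedLawHyp τ bm bp) {ρB : Measure ℝ}
    (hρ : ρB = volume.withDensity fun s => ENNReal.ofReal (τ s)) : ∀ᵐ b ∂ρB, b ∈ Set.Icc bm bp := by
  have hρ0 : ρB (Set.Icc bm bp)ᶜ = 0 := by
    rw [hρ, withDensity_apply _ measurableSet_Icc.compl]
    have : ∀ s ∈ (Set.Icc bm bp)ᶜ, ENNReal.ofReal (τ s) = 0 := fun s hs => by
      rw [hτ.eq_zero s hs, ENNReal.ofReal_zero]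
    rw [setLIntegral_congr_fun measurableSet_Icc.compl this, lintegral_zero]
  rw [ae_iff]; exact hρ0

/-- Continuous functions are `ρ_B`-integrable (the law has compact support). [folklore] -/
theorem integrable_rhoB_of_continuous (hτ : ReducedLawHyp τ bm bp) {ρB : Measure ℝ}
    (hρ : ρB = volume.withDensity fun s => ENNReal.ofReal (τ s)) {g : ℝ → ℝ} (hg : Continuous g) :
    Integrable g ρB := by
  obtain ⟨C, hC⟩ := isCompact_Icc.exists_bound_of_continuousOn (s := Set.Icc bm bp) hg.continuousOn
  exact integrable_rhoB_of_integrable_mul hτ hρ (hτ.integrable_mul hg.aestronglyMeasurable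
    fun b hb => by rw [← Real.norm_eq_abs]; exact hC b hb)

/-- `|∫ f dρ_B| ≤ C` when `|f| ≤ C` on the support. [folklore] -/
theorem abs_integral_rhoB_le (hτ : ReducedLawHyp τ bm bp) {ρB : Measure ℝ} [IsProbabilityMeasure ρB]
    (hρ : ρB = volume.withDensity fun s => ENNReal.ofReal (τ s)) {f : ℝ → ℝ} {C : ℝ}
    (hC : ∀ b ∈ Set.Icc bm bp, |f b| ≤ C) : |∫ b, f b ∂ρB| ≤ C := by
  have h := norm_integral_le_of_norm_le_const (μ := ρB) (f := f) (C := C) (by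
    filter_upwards [ae_mem_Icc_rhoB hτ hρ] with b hb
    rw [Real.norm_eq_abs]; exact hC b hb)
  rw [Real.norm_eq_abs] at h
  simpa using h

/-- `σ̂² = ∫ b² ρ_B(db)`. [cite: AjankiHuveneers2011, App. 7.3 (`𝔼(B²)`)] -/
def bM2 (ρB : Measure ℝ) : ℝ := ∫ b, b ^ 2 ∂ρB

/-- `κ₃ = ∫ b(b² - σ̂²) ρ_B(db)`. [folklore] -/
def bK3 (ρB : Measure ℝ) : ℝ := ∫ b, b * (b ^ 2 - bM2 ρB) ∂ρB

/-- `κ₄ = ∫ (b² - σ̂²)² ρ_B(db)`. [folklore] -/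
def bK4 (ρB : Measure ℝ) : ℝ := ∫ b, (b ^ 2 - bM2 ρB) ^ 2 ∂ρB

/-- The quadratic-variation increment of the law `ρ_B`: `q(y) = clQ w σ̂² κ₃ κ₄ y`. [folklore] -/
def clQ' (ρB : Measure ℝ) (w y : ℝ) : ℝ := clQ w (bM2 ρB) (bK3 ρB) (bK4 ρB) y

/-- `q` of the law is continuous (compositional form for `fun_prop`). [folklore] -/
@[fun_prop]
theorem continuous_clQ'_comp {α : Type*} [TopologicalSpace α] {f : α → ℝ} (hf : Continuous f)
    (ρB : Measure ℝ) (w : ℝ) : Continuous fun a => clQ' ρB w (f a) := by unfold clQ'; fun_prop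

set_option maxHeartbeats 800000 in
/-- **One step of the exponential martingale**: for `|θ| ≤ Θ` and small `w`, uniformly in `y`:
`0 ≤ q(y) ≤ C_q w²`, `θ²q(y)/2 ≤ 1`, `|e^{θ²q(y)/2} ∫cos(θ m̃(y,b)) ρ_B(db) - 1| ≤ C_A w³`,
`|e^{θ²q(y)/2} ∫sin(θ m̃(y,b)) ρ_B(db)| ≤ C_A w³`. [folklore] -/
theorem one_step_trig (hτ : ReducedLawHyp τ bm bp) {ρB : Measure ℝ} [IsProbabilityMeasure ρB]
    (hρ : ρB = volume.withDensity fun s => ENNReal.ofReal (τ s)) {Θ : ℝ} (hΘ : 0 ≤ Θ) :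
    ∃ wA Cq CA : ℝ, 0 < wA ∧ wA ≤ 1 ∧ 0 ≤ Cq ∧ 0 ≤ CA ∧ ∀ w ∈ Set.Ioc 0 wA, ∀ θ : ℝ, |θ| ≤ Θ → ∀ y : ℝ,
      (0 ≤ clQ' ρB w y ∧ clQ' ρB w y ≤ Cq * w ^ 2) ∧ θ ^ 2 * clQ' ρB w y / 2 ≤ 1 ∧
      |Real.exp (θ ^ 2 * clQ' ρB w y / 2) * (∫ b, Real.cos (θ * clInc w (bM2 ρB) y b) ∂ρB) - 1| ≤ CA * w ^ 3 ∧
      |Real.exp (θ ^ 2 * clQ' ρB w y / 2) * (∫ b, Real.sin (θ * clInc w (bM2 ρB) y b) ∂ρB)| ≤ CA * w ^ 3 := by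
  set σ2 : ℝ := bM2 ρB with hσ2
  set κ3 : ℝ := bK3 ρB with hκ3
  set κ4 : ℝ := bK4 ρB with hκ4
  have hQ' : ∀ w y, clQ' ρB w y = clQ w σ2 κ3 κ4 y := fun w y => rfl
  set bstar : ℝ := max |bm| |bp| with hbstar
  have hbstar0 : 0 ≤ bstar := le_max_of_le_left (abs_nonneg _)
  have hσ0 : 0 ≤ σ2 := integral_nonneg fun b => sq_nonneg b
  have hκ40 : 0 ≤ κ4 := integral_nonneg fun b => sq_nonneg _
  -- constants
  set Cm : ℝ := bstar + (bstar ^ 2 + σ2) * (π / 2) with hCm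
  have hCm0 : 0 ≤ Cm := by positivity
  set Cq : ℝ := σ2 + π * |κ3| + π ^ 2 / 4 * κ4 with hCqdef
  have hCq0 : 0 ≤ Cq := by positivity
  set CA : ℝ := (Θ ^ 2 * Cq / 2) ^ 2 + 3 * (Θ * Cm) ^ 4 + 3 * (Θ * Cm) ^ 3 with hCAdef
  have hCA0 : 0 ≤ CA := by positivity
  set wA : ℝ := min 1 (1 / (Θ * Cm + Θ ^ 2 * Cq + 1)) with hwA
  have hwA0 : 0 < wA := by positivity
  refine ⟨wA, Cq, CA, hwA0, min_le_left _ _, hCq0, hCA0, ?_⟩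
  intro w hw θ hθ y
  rw [hQ' w y]
  obtain ⟨hw0, hwle⟩ := hw
  have hw1 : w ≤ 1 := hwle.trans (min_le_left _ _)
  have hwD : w ≤ 1 / (Θ * Cm + Θ ^ 2 * Cq + 1) := hwle.trans (min_le_right _ _)
  have hD : 0 < Θ * Cm + Θ ^ 2 * Cq + 1 := by positivity
  have hwD' : w * (Θ * Cm + Θ ^ 2 * Cq + 1) ≤ 1 := by rwa [le_div_iff₀ hD] at hwD
  have eD : w * (Θ * Cm + Θ ^ 2 * Cq + 1) = Θ * Cm * w + Θ ^ 2 * Cq * w + w := by ring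
  have hnn1 : 0 ≤ Θ * Cm * w := by positivity
  have hnn2 : 0 ≤ Θ ^ 2 * Cq * w := by positivity
  have hΘCm : Θ * Cm * w ≤ 1 := by linarith only [hwD', eD, hnn2, hw0.le]
  have hΘCq : Θ ^ 2 * Cq * w ≤ 1 := by linarith only [hwD', eD, hnn1, hw0.le]
  have hθ2 : θ ^ 2 ≤ Θ ^ 2 := by rw [← sq_abs]; exact pow_le_pow_left₀ (abs_nonneg _) hθ 2
  -- the increment on the support
  have hs := clS_mem y
  have hH := abs_clH_le y
  have hmb : ∀ b ∈ Set.Icc bm bp, |clInc w σ2 y b| ≤ Cm * w := by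
    intro b hb
    have hbB : |b| ≤ bstar := ReducedLawHyp.abs_le_of_mem hb
    have hb2 : b ^ 2 ≤ bstar ^ 2 := by rw [← sq_abs]; exact pow_le_pow_left₀ (abs_nonneg _) hbB 2
    unfold clInc
    refine (abs_add_le _ _).trans ?_
    have h1 : |w * b * clS y| ≤ w * bstar := by
      rw [abs_mul, abs_mul, abs_of_pos hw0, abs_of_nonneg hs.1]
      calc w * |b| * clS y ≤ w * bstar * 1 := mul_le_mul (mul_le_mul_of_nonneg_left hbB hw0.le) hs.2 hs.1 (by positivity)
        _ = w * bstar := mul_one _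
    have h2 : |w ^ 2 * (b ^ 2 - σ2) * (π / 2) * clH y| ≤ w * ((bstar ^ 2 + σ2) * (π / 2)) := by
      rw [abs_mul, abs_mul, abs_mul, abs_of_pos (by positivity : (0:ℝ) < w ^ 2),
        abs_of_pos (by positivity : (0:ℝ) < π / 2)]
      have h3 : |b ^ 2 - σ2| ≤ bstar ^ 2 + σ2 := by
        rw [abs_le]; constructor <;> linarith only [sq_nonneg b, hb2, hσ0]
      have hw2 : w ^ 2 ≤ w := by nlinarith only [hw0, hw1]
      have h0 : 0 ≤ (bstar ^ 2 + σ2) * (π / 2) := by positivity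
      calc w ^ 2 * |b ^ 2 - σ2| * (π / 2) * |clH y| ≤ w ^ 2 * (bstar ^ 2 + σ2) * (π / 2) * 1 := by
            refine mul_le_mul ?_ hH (abs_nonneg _) (by positivity)
            exact mul_le_mul_of_nonneg_right (mul_le_mul_of_nonneg_left h3 (by positivity)) (by positivity)
        _ = w ^ 2 * ((bstar ^ 2 + σ2) * (π / 2)) := by ring
        _ ≤ w * ((bstar ^ 2 + σ2) * (π / 2)) := mul_le_mul_of_nonneg_right hw2 h0
    calc |w * b * clS y| + |w ^ 2 * (b ^ 2 - σ2) * (π / 2) * clH y| ≤ w * bstar + w * ((bstar ^ 2 + σ2) * (π / 2)) :=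
          add_le_add h1 h2
      _ = Cm * w := by rw [hCm]; ring
  have hθm : ∀ b ∈ Set.Icc bm bp, |θ * clInc w σ2 y b| ≤ Θ * Cm * w := by
    intro b hb
    rw [abs_mul]
    calc |θ| * |clInc w σ2 y b| ≤ Θ * (Cm * w) := mul_le_mul hθ (hmb b hb) (abs_nonneg _) hΘ
      _ = Θ * Cm * w := by ring
  have hθm1 : ∀ b ∈ Set.Icc bm bp, |θ * clInc w σ2 y b| ≤ 1 := fun b hb => (hθm b hb).trans hΘCm
  -- integrability of polynomials in `b`
  have hIpoly : ∀ g : ℝ → ℝ, Continuous g → Integrable g ρB := fun g hg => integrable_rhoB_of_continuous hτ hρ hg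
  have hcInc : Continuous fun b => clInc w σ2 y b := by fun_prop
  -- the first two moments
  have hmean : ∫ b, clInc w σ2 y b ∂ρB = 0 := by
    have e : (fun b => clInc w σ2 y b) = fun b => (w * clS y) * b + (w ^ 2 * (π / 2) * clH y) * (b ^ 2 - σ2) := by
      funext b; unfold clInc; ring
    have i1 : Integrable (fun b : ℝ => (w * clS y) * b) ρB := (hIpoly (fun b => b) continuous_id').const_mul _
    have i2 : Integrable (fun b : ℝ => (w ^ 2 * (π / 2) * clH y) * (b ^ 2 - σ2)) ρB :=
      (hIpoly (fun b => b ^ 2 - σ2) (by fun_prop)).const_mul _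
    have i3 : Integrable (fun b : ℝ => b ^ 2) ρB := hIpoly _ (by fun_prop)
    rw [e, integral_add i1 i2, integral_const_mul, integral_const_mul, integral_sub i3 (integrable_const _)]
    have h1 : ∫ b, b ∂ρB = 0 := by rw [integral_rhoB hτ hρ]; exact hτ.mean_zero
    have h2 : ∫ b : ℝ, b ^ 2 ∂ρB = σ2 := rfl
    rw [h1, integral_const, probReal_univ, one_smul, h2, sub_self, mul_zero, mul_zero, add_zero]
  have hvar : ∫ b, clInc w σ2 y b ^ 2 ∂ρB = clQ w σ2 κ3 κ4 y := by
    simp_rw [clInc_sq]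
    have i1 : Integrable (fun b : ℝ => w ^ 2 * b ^ 2 * clS y ^ 2) ρB := hIpoly _ (by fun_prop)
    have i2 : Integrable (fun b : ℝ => w ^ 3 * π * (b * (b ^ 2 - σ2)) * (clS y * clH y)) ρB := hIpoly _ (by fun_prop)
    have i3 : Integrable (fun b : ℝ => w ^ 4 * (π ^ 2 / 4) * (b ^ 2 - σ2) ^ 2 * clH y ^ 2) ρB := hIpoly _ (by fun_prop)
    have i12 : Integrable (fun b : ℝ => w ^ 2 * b ^ 2 * clS y ^ 2 + w ^ 3 * π * (b * (b ^ 2 - σ2)) * (clS y * clH y)) ρB :=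
      i1.add i2
    rw [integral_add i12 i3, integral_add i1 i2]
    have e1 : ∫ b, w ^ 2 * b ^ 2 * clS y ^ 2 ∂ρB = w ^ 2 * σ2 * clS y ^ 2 := by
      rw [show (fun b : ℝ => w ^ 2 * b ^ 2 * clS y ^ 2) = fun b => (w ^ 2 * clS y ^ 2) * b ^ 2 from funext fun b => by ring,
        integral_const_mul]
      show w ^ 2 * clS y ^ 2 * bM2 ρB = w ^ 2 * σ2 * clS y ^ 2
      rw [← hσ2]; ring
    have e2 : ∫ b, w ^ 3 * π * (b * (b ^ 2 - σ2)) * (clS y * clH y) ∂ρB = w ^ 3 * π * κ3 * (clS y * clH y) := by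
      rw [show (fun b : ℝ => w ^ 3 * π * (b * (b ^ 2 - σ2)) * (clS y * clH y)) =
        fun b => (w ^ 3 * π * (clS y * clH y)) * (b * (b ^ 2 - σ2)) from funext fun b => by ring,
        integral_const_mul]
      show w ^ 3 * π * (clS y * clH y) * bK3 ρB = _
      rw [← hκ3]; ring
    have e3 : ∫ b, w ^ 4 * (π ^ 2 / 4) * (b ^ 2 - σ2) ^ 2 * clH y ^ 2 ∂ρB = w ^ 4 * (π ^ 2 / 4) * κ4 * clH y ^ 2 := by
      rw [show (fun b : ℝ => w ^ 4 * (π ^ 2 / 4) * (b ^ 2 - σ2) ^ 2 * clH y ^ 2) =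
        fun b => (w ^ 4 * (π ^ 2 / 4) * clH y ^ 2) * (b ^ 2 - σ2) ^ 2 from funext fun b => by ring,
        integral_const_mul]
      show w ^ 4 * (π ^ 2 / 4) * clH y ^ 2 * bK4 ρB = _
      rw [← hκ4]; ring
    rw [e1, e2, e3]; unfold clQ; ring
  -- `0 ≤ q ≤ C_q w²`, `u ≤ 1`
  have hq0 : 0 ≤ clQ w σ2 κ3 κ4 y := by rw [← hvar]; exact integral_nonneg fun b => sq_nonneg _
  have hw2 : w ^ 2 ≤ w := by nlinarith only [hw0, hw1]
  have hw32 : w ^ 3 ≤ w ^ 2 := by nlinarith only [hw0, hw1]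
  have hw42 : w ^ 4 ≤ w ^ 2 := by nlinarith only [hw0, hw1, hw32]
  have hqle : clQ w σ2 κ3 κ4 y ≤ Cq * w ^ 2 := by
    unfold clQ
    have h1 : w ^ 2 * σ2 * clS y ^ 2 ≤ w ^ 2 * σ2 := by
      have : clS y ^ 2 ≤ 1 := pow_le_one₀ hs.1 hs.2
      calc w ^ 2 * σ2 * clS y ^ 2 ≤ w ^ 2 * σ2 * 1 := mul_le_mul_of_nonneg_left this (by positivity)
        _ = w ^ 2 * σ2 := mul_one _
    have h2 : w ^ 3 * π * κ3 * (clS y * clH y) ≤ w ^ 2 * (π * |κ3|) := by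
      have hsh : |clS y * clH y| ≤ 1 := by
        rw [abs_mul, abs_of_nonneg hs.1]; exact mul_le_one₀ hs.2 (abs_nonneg _) hH
      calc w ^ 3 * π * κ3 * (clS y * clH y) ≤ |w ^ 3 * π * κ3 * (clS y * clH y)| := le_abs_self _
        _ = w ^ 3 * π * (|κ3| * |clS y * clH y|) := by
            rw [abs_mul, abs_mul, abs_mul, abs_of_pos (pow_pos hw0 3), abs_of_pos Real.pi_pos]; ring
        _ ≤ w ^ 3 * π * (|κ3| * 1) :=
            mul_le_mul_of_nonneg_left (mul_le_mul_of_nonneg_left hsh (abs_nonneg _)) (by positivity)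
        _ = w ^ 3 * (π * |κ3|) := by ring
        _ ≤ w ^ 2 * (π * |κ3|) := mul_le_mul_of_nonneg_right hw32 (by positivity)
    have h3 : w ^ 4 * (π ^ 2 / 4) * κ4 * clH y ^ 2 ≤ w ^ 2 * (π ^ 2 / 4 * κ4) := by
      have hh2 : clH y ^ 2 ≤ 1 := by rw [← sq_abs]; exact pow_le_one₀ (abs_nonneg _) hH
      calc w ^ 4 * (π ^ 2 / 4) * κ4 * clH y ^ 2 ≤ w ^ 4 * (π ^ 2 / 4) * κ4 * 1 :=
            mul_le_mul_of_nonneg_left hh2 (by positivity)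
        _ = w ^ 4 * (π ^ 2 / 4 * κ4) := by ring
        _ ≤ w ^ 2 * (π ^ 2 / 4 * κ4) := mul_le_mul_of_nonneg_right hw42 (by positivity)
    calc _ ≤ w ^ 2 * σ2 + w ^ 2 * (π * |κ3|) + w ^ 2 * (π ^ 2 / 4 * κ4) := add_le_add (add_le_add h1 h2) h3
      _ = Cq * w ^ 2 := by rw [hCqdef]; ring
  set u : ℝ := θ ^ 2 * clQ w σ2 κ3 κ4 y / 2 with hu
  have hu0 : 0 ≤ u := by positivity
  have hule : u ≤ Θ ^ 2 * Cq * w ^ 2 / 2 := by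
    rw [hu]
    have := mul_le_mul hθ2 hqle hq0 (sq_nonneg Θ)
    linarith only [this]
  have hu1 : u ≤ 1 := by
    have : Θ ^ 2 * Cq * w ^ 2 ≤ 1 := by
      calc Θ ^ 2 * Cq * w ^ 2 = (Θ ^ 2 * Cq * w) * w := by ring
        _ ≤ 1 * 1 := mul_le_mul hΘCq hw1 hw0.le zero_le_one
        _ = 1 := one_mul _
    linarith only [hule, this]
  -- the cosine integral
  have hIcos : Integrable (fun b => Real.cos (θ * clInc w σ2 y b)) ρB := hIpoly _ (by fun_prop)
  have hIsin : Integrable (fun b => Real.sin (θ * clInc w σ2 y b)) ρB := hIpoly _ (by fun_prop)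
  have hpow3 : ∀ b ∈ Set.Icc bm bp, |θ * clInc w σ2 y b| ^ 3 ≤ (Θ * Cm * w) ^ 3 := fun b hb =>
    pow_le_pow_left₀ (abs_nonneg _) (hθm b hb) 3
  have hcos : |∫ b, Real.cos (θ * clInc w σ2 y b) ∂ρB - (1 - u)| ≤ (Θ * Cm * w) ^ 3 := by
    have hI2 : Integrable (fun b => (θ * clInc w σ2 y b) ^ 2 / 2) ρB := (hIpoly _ (by fun_prop)).div_const _
    have e : ∫ b, Real.cos (θ * clInc w σ2 y b) ∂ρB - (1 - u) =
        ∫ b, (Real.cos (θ * clInc w σ2 y b) - (1 - (θ * clInc w σ2 y b) ^ 2 / 2)) ∂ρB := by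
      have i4 : Integrable (fun b => 1 - (θ * clInc w σ2 y b) ^ 2 / 2) ρB := (integrable_const _).sub hI2
      rw [integral_sub hIcos i4, integral_sub (integrable_const _) hI2, integral_const, probReal_univ, one_smul]
      congr 2
      rw [hu, integral_div]
      congr 1
      rw [show (fun b => (θ * clInc w σ2 y b) ^ 2) = fun b => θ ^ 2 * clInc w σ2 y b ^ 2 from funext fun b => by ring,
        integral_const_mul, hvar]
    rw [e]
    refine abs_integral_rhoB_le hτ hρ fun b hb => ?_
    refine (abs_cos_sub_le (hθm1 b hb)).trans (le_trans ?_ (hpow3 b hb))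
    have e4 : (θ * clInc w σ2 y b) ^ 4 = |θ * clInc w σ2 y b| ^ 3 * |θ * clInc w σ2 y b| := by
      rw [← pow_succ, ← abs_pow]
      exact (abs_of_nonneg (by positivity)).symm
    rw [e4]
    exact mul_le_of_le_one_right (by positivity) (hθm1 b hb)
  -- the sine integral
  have hsin : |∫ b, Real.sin (θ * clInc w σ2 y b) ∂ρB| ≤ (Θ * Cm * w) ^ 3 := by
    have e : ∫ b, Real.sin (θ * clInc w σ2 y b) ∂ρB = ∫ b, (Real.sin (θ * clInc w σ2 y b) - θ * clInc w σ2 y b) ∂ρB := by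
      rw [integral_sub hIsin ((hIpoly _ hcInc).const_mul θ), integral_const_mul, hmean, mul_zero, sub_zero]
    rw [e]
    refine abs_integral_rhoB_le hτ hρ fun b hb => ?_
    exact (abs_sin_sub_self_le (hθm1 b hb)).trans (hpow3 b hb)
  -- conclusion
  have heu : Real.exp u ≤ 3 := by
    have := Real.exp_one_lt_d9
    calc Real.exp u ≤ Real.exp 1 := Real.exp_le_exp.mpr hu1
      _ ≤ 3 := by linarith only [this]
  have hw3 : (Θ * Cm * w) ^ 3 = (Θ * Cm) ^ 3 * w ^ 3 := by ring
  have hw30 : 0 ≤ w ^ 3 := by positivity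
  refine ⟨⟨hq0, hqle⟩, hu1, ?_, ?_⟩
  · -- `e^u ∫cos - 1 = (e^u(1-u) - 1) + e^u (∫cos - (1-u))`
    have e : Real.exp u * (∫ b, Real.cos (θ * clInc w σ2 y b) ∂ρB) - 1 =
        (Real.exp u * (1 - u) - 1) + Real.exp u * (∫ b, Real.cos (θ * clInc w σ2 y b) ∂ρB - (1 - u)) := by ring
    rw [e]
    refine (abs_add_le _ _).trans ?_
    have h1 := abs_exp_mul_one_sub_sub_one_le hu1
    have h2 : |Real.exp u * (∫ b, Real.cos (θ * clInc w σ2 y b) ∂ρB - (1 - u))| ≤ 3 * ((Θ * Cm) ^ 3 * w ^ 3) := by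
      rw [abs_mul, abs_of_pos (Real.exp_pos _), ← hw3]
      exact mul_le_mul heu hcos (abs_nonneg _) (by norm_num)
    have h3 : u ^ 2 ≤ (Θ ^ 2 * Cq / 2) ^ 2 * w ^ 3 := by
      have h4 : u ≤ (Θ ^ 2 * Cq / 2) * w ^ 2 := by linarith only [hule]
      calc u ^ 2 ≤ ((Θ ^ 2 * Cq / 2) * w ^ 2) ^ 2 := pow_le_pow_left₀ hu0 h4 2
        _ = (Θ ^ 2 * Cq / 2) ^ 2 * w ^ 3 * w := by ring
        _ ≤ (Θ ^ 2 * Cq / 2) ^ 2 * w ^ 3 * 1 := mul_le_mul_of_nonneg_left hw1 (by positivity)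
        _ = (Θ ^ 2 * Cq / 2) ^ 2 * w ^ 3 := mul_one _
    have h5 : 0 ≤ 3 * (Θ * Cm) ^ 4 * w ^ 3 := by positivity
    have eCA : CA * w ^ 3 = (Θ ^ 2 * Cq / 2) ^ 2 * w ^ 3 + 3 * (Θ * Cm) ^ 4 * w ^ 3 + 3 * ((Θ * Cm) ^ 3 * w ^ 3) := by
      rw [hCAdef]; ring
    calc |Real.exp u * (1 - u) - 1| + |Real.exp u * (∫ b, Real.cos (θ * clInc w σ2 y b) ∂ρB - (1 - u))|
        ≤ (Θ ^ 2 * Cq / 2) ^ 2 * w ^ 3 + 3 * ((Θ * Cm) ^ 3 * w ^ 3) := add_le_add (h1.trans h3) h2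
      _ ≤ CA * w ^ 3 := by linarith only [eCA, h5]
  · rw [abs_mul, abs_of_pos (Real.exp_pos _)]
    have h5 : 0 ≤ ((Θ ^ 2 * Cq / 2) ^ 2 + 3 * (Θ * Cm) ^ 4) * w ^ 3 := by positivity
    have eCA : CA * w ^ 3 = ((Θ ^ 2 * Cq / 2) ^ 2 + 3 * (Θ * Cm) ^ 4) * w ^ 3 + 3 * (Θ * Cm) ^ 3 * w ^ 3 := by
      rw [hCAdef]; ring
    calc Real.exp u * |∫ b, Real.sin (θ * clInc w σ2 y b) ∂ρB| ≤ 3 * (Θ * Cm * w) ^ 3 :=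
          mul_le_mul heu hsin (abs_nonneg _) (by norm_num)
      _ = 3 * (Θ * Cm) ^ 3 * w ^ 3 := by ring
      _ ≤ CA * w ^ 3 := by linarith only [eCA, h5]

/-! ### The exponential martingale, peeled one reduced mass at a time -/

/-- The martingale `M_l = ∑_{k<l} m̃(X_k, B_k)`. [folklore] -/
def clM (w σ2 x : ℝ) (B : ℕ → ℝ) (l : ℕ) : ℝ := ∑ k ∈ Finset.range l, clInc w σ2 (ahPhase w x B k) (B k)

/-- Its predictable quadratic variation `A_l = ∑_{k<l} q(X_k)`. [folklore] -/
def clA (ρB : Measure ℝ) (w x : ℝ) (B : ℕ → ℝ) (l : ℕ) : ℝ := ∑ k ∈ Finset.range l, clQ' ρB w (ahPhase w x B k)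

/-- `M_{l+1} = M_l + m̃(X_l, B_l)`. [folklore] -/
theorem clM_succ (w σ2 x : ℝ) (B : ℕ → ℝ) (l : ℕ) :
    clM w σ2 x B (l + 1) = clM w σ2 x B l + clInc w σ2 (ahPhase w x B l) (B l) := by
  unfold clM; rw [Finset.sum_range_succ]

/-- `A_{l+1} = A_l + q(X_l)`. [folklore] -/
theorem clA_succ (ρB : Measure ℝ) (w x : ℝ) (B : ℕ → ℝ) (l : ℕ) :
    clA ρB w x B (l + 1) = clA ρB w x B l + clQ' ρB w (ahPhase w x B l) := by
  unfold clA; rw [Finset.sum_range_succ]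

/-- `M_l` does not read `B_l`. [folklore] -/
theorem clM_update (w σ2 x : ℝ) (B : ℕ → ℝ) (l : ℕ) (b : ℝ) : clM w σ2 x (update B l b) l = clM w σ2 x B l := by
  unfold clM
  refine Finset.sum_congr rfl fun k hk => ?_
  have hkl : k < l := Finset.mem_range.mp hk
  rw [ahPhase_update_of_le w x B hkl.le, update_of_ne (ne_of_lt hkl)]

/-- `A_l` does not read `B_l`. [folklore] -/
theorem clA_update (ρB : Measure ℝ) (w x : ℝ) (B : ℕ → ℝ) (l : ℕ) (b : ℝ) :
    clA ρB w x (update B l b) l = clA ρB w x B l := by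
  unfold clA
  refine Finset.sum_congr rfl fun k hk => ?_
  rw [ahPhase_update_of_le w x B (Finset.mem_range.mp hk).le]

/-- `0 ≤ A_l ≤ l C_q w²` when `0 ≤ q ≤ C_q w²`. [folklore] -/
theorem clA_bounds (ρB : Measure ℝ) {w Cq : ℝ} (hq : ∀ y, 0 ≤ clQ' ρB w y ∧ clQ' ρB w y ≤ Cq * w ^ 2)
    (x : ℝ) (B : ℕ → ℝ) (l : ℕ) : 0 ≤ clA ρB w x B l ∧ clA ρB w x B l ≤ l * (Cq * w ^ 2) := by
  unfold clA
  constructor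
  · exact Finset.sum_nonneg fun k _ => (hq _).1
  · calc ∑ k ∈ Finset.range l, clQ' ρB w (ahPhase w x B k) ≤ ∑ _k ∈ Finset.range l, Cq * w ^ 2 :=
          Finset.sum_le_sum fun k _ => (hq _).2
      _ = l * (Cq * w ^ 2) := by rw [Finset.sum_const, Finset.card_range, nsmul_eq_mul]

/-- Measurability of `M_l`, `A_l` in the disorder. [folklore] -/
theorem measurable_clM_clA (ρB : Measure ℝ) (w σ2 x : ℝ) {N : ℕ} (l : ℕ) :
    Measurable (fun B : Fin N → ℝ => clM w σ2 x (finExt B) l) ∧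
      Measurable (fun B : Fin N → ℝ => clA ρB w x (finExt B) l) := by
  have hcS : Continuous clS := by unfold clS; fun_prop
  have hcH : Continuous clH := by unfold clH; fun_prop
  have hInc : Continuous fun p : ℝ × ℝ => clInc w σ2 p.1 p.2 := by fun_prop
  have hQ : Continuous fun y => clQ' ρB w y := by fun_prop
  constructor
  · unfold clM
    refine Finset.measurable_sum _ fun k _ => ?_
    exact hInc.measurable.comp ((measurable_ahPhase_pi w x k).prodMk (measurable_finExt k))
  · unfold clA
    exact Finset.measurable_sum _ fun k _ => hQ.measurable.comp (measurable_ahPhase_pi w x k)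

set_option maxHeartbeats 800000 in
/-- **One peeling step**: `|𝔼 R^c_{l+1} - 𝔼 R^c_l|, |𝔼 R^s_{l+1} - 𝔼 R^s_l| ≤ 2 e^{Θ²C_q/2} C_A w³` for
`R^c_l = e^{θ²A_l/2} cos θM_l`, `R^s_l = e^{θ²A_l/2} sin θM_l`, `l < N`, `w²N ≤ 1` (integrate the
`l`-th reduced mass first). [folklore] -/
theorem peel_step (hτ : ReducedLawHyp τ bm bp) {ρB : Measure ℝ} [IsProbabilityMeasure ρB]
    (hρ : ρB = volume.withDensity fun s => ENNReal.ofReal (τ s)) {Θ w θ Cq CA : ℝ} (hw0 : 0 < w)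
    (hstep : ∀ y : ℝ, (0 ≤ clQ' ρB w y ∧ clQ' ρB w y ≤ Cq * w ^ 2) ∧ θ ^ 2 * clQ' ρB w y / 2 ≤ 1 ∧
      |Real.exp (θ ^ 2 * clQ' ρB w y / 2) * (∫ b, Real.cos (θ * clInc w (bM2 ρB) y b) ∂ρB) - 1| ≤ CA * w ^ 3 ∧
      |Real.exp (θ ^ 2 * clQ' ρB w y / 2) * (∫ b, Real.sin (θ * clInc w (bM2 ρB) y b) ∂ρB)| ≤ CA * w ^ 3)
    (hθ : |θ| ≤ Θ) (x : ℝ) {N : ℕ} (hN : w ^ 2 * N ≤ 1) {l : ℕ} (hl : l < N) :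
    |∫ B, Real.exp (θ ^ 2 * clA ρB w x (finExt B) (l + 1) / 2) * Real.cos (θ * clM w (bM2 ρB) x (finExt B) (l + 1))
        ∂(Measure.pi fun _ : Fin N => ρB) -
      ∫ B, Real.exp (θ ^ 2 * clA ρB w x (finExt B) l / 2) * Real.cos (θ * clM w (bM2 ρB) x (finExt B) l)
        ∂(Measure.pi fun _ : Fin N => ρB)| ≤ 2 * Real.exp (Θ ^ 2 * Cq / 2) * CA * w ^ 3 ∧
    |∫ B, Real.exp (θ ^ 2 * clA ρB w x (finExt B) (l + 1) / 2) * Real.sin (θ * clM w (bM2 ρB) x (finExt B) (l + 1))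
        ∂(Measure.pi fun _ : Fin N => ρB) -
      ∫ B, Real.exp (θ ^ 2 * clA ρB w x (finExt B) l / 2) * Real.sin (θ * clM w (bM2 ρB) x (finExt B) l)
        ∂(Measure.pi fun _ : Fin N => ρB)| ≤ 2 * Real.exp (Θ ^ 2 * Cq / 2) * CA * w ^ 3 := by
  set σ2 := bM2 ρB with hσ2
  set μ := (Measure.pi fun _ : Fin N => ρB) with hμ
  set E : ℝ := Real.exp (Θ ^ 2 * Cq / 2) with hE
  obtain ⟨n, rfl⟩ : ∃ n, N = n + 1 := ⟨N - 1, by omega⟩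
  set lF : Fin (n + 1) := ⟨l, hl⟩ with hlF
  -- notation
  set X : (Fin (n + 1) → ℝ) → ℕ → ℝ := fun B k => ahPhase w x (finExt B) k with hX
  set A : (Fin (n + 1) → ℝ) → ℝ := fun B => clA ρB w x (finExt B) l with hA
  set M : (Fin (n + 1) → ℝ) → ℝ := fun B => clM w σ2 x (finExt B) l with hM
  have hq : ∀ y, 0 ≤ clQ' ρB w y ∧ clQ' ρB w y ≤ Cq * w ^ 2 := fun y => (hstep y).1
  have hCq0 : 0 ≤ Cq := by
    have := (hq 0); nlinarith [pow_pos hw0 2]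
  have hθ2 : θ ^ 2 ≤ Θ ^ 2 := by rw [← sq_abs]; exact pow_le_pow_left₀ (abs_nonneg _) hθ 2
  -- the weight is bounded by `E`
  have hexpA : ∀ B, 0 < Real.exp (θ ^ 2 * A B / 2) ∧ Real.exp (θ ^ 2 * A B / 2) ≤ E := by
    intro B
    refine ⟨Real.exp_pos _, Real.exp_le_exp.mpr ?_⟩
    obtain ⟨h0, h1⟩ := clA_bounds ρB hq x (finExt B) l
    have hlN : (l : ℝ) * (Cq * w ^ 2) ≤ Cq := by
      have hl' : (l : ℝ) ≤ n + 1 := by exact_mod_cast hl.le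
      have hN' : w ^ 2 * ((n : ℝ) + 1) ≤ 1 := by exact_mod_cast hN
      calc (l : ℝ) * (Cq * w ^ 2) ≤ (n + 1) * (Cq * w ^ 2) := mul_le_mul_of_nonneg_right hl' (by positivity)
        _ = Cq * (w ^ 2 * (n + 1)) := by ring
        _ ≤ Cq * 1 := mul_le_mul_of_nonneg_left hN' hCq0
        _ = Cq := mul_one _
    have hA1 : A B ≤ Cq := h1.trans hlN
    have := mul_le_mul hθ2 hA1 h0 (sq_nonneg Θ)
    linarith
  -- predictability under resampling of `B_l`
  have hupd : ∀ (B : Fin (n + 1) → ℝ) (b : ℝ),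
      A (update B lF b) = A B ∧ M (update B lF b) = M B ∧ X (update B lF b) l = X B l ∧
        finExt (update B lF b) l = b := by
    intro B b
    simp only [hA, hM, hX]
    rw [finExt_update]
    refine ⟨clA_update ρB w x _ l b, clM_update w σ2 x _ l b, ahPhase_update_of_le w x _ le_rfl b, ?_⟩
    simp [hlF]
  -- the step identities
  have hstepc : ∀ B : Fin (n + 1) → ℝ,
      Real.exp (θ ^ 2 * clA ρB w x (finExt B) (l + 1) / 2) * Real.cos (θ * clM w σ2 x (finExt B) (l + 1)) -
        Real.exp (θ ^ 2 * A B / 2) * Real.cos (θ * M B) =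
      Real.exp (θ ^ 2 * A B / 2) * (Real.cos (θ * M B) *
        (Real.exp (θ ^ 2 * clQ' ρB w (X B l) / 2) * Real.cos (θ * clInc w σ2 (X B l) (finExt B l)) - 1) -
        Real.sin (θ * M B) * (Real.exp (θ ^ 2 * clQ' ρB w (X B l) / 2) * Real.sin (θ * clInc w σ2 (X B l) (finExt B l)))) := by
    intro B
    simp only [hA, hM, hX]
    rw [clA_succ, clM_succ, mul_add, add_div, Real.exp_add, mul_add θ, Real.cos_add]
    ring
  have hsteps : ∀ B : Fin (n + 1) → ℝ,
      Real.exp (θ ^ 2 * clA ρB w x (finExt B) (l + 1) / 2) * Real.sin (θ * clM w σ2 x (finExt B) (l + 1)) -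
        Real.exp (θ ^ 2 * A B / 2) * Real.sin (θ * M B) =
      Real.exp (θ ^ 2 * A B / 2) * (Real.sin (θ * M B) *
        (Real.exp (θ ^ 2 * clQ' ρB w (X B l) / 2) * Real.cos (θ * clInc w σ2 (X B l) (finExt B l)) - 1) +
        Real.cos (θ * M B) * (Real.exp (θ ^ 2 * clQ' ρB w (X B l) / 2) * Real.sin (θ * clInc w σ2 (X B l) (finExt B l)))) := by
    intro B
    simp only [hA, hM, hX]
    rw [clA_succ, clM_succ, mul_add, add_div, Real.exp_add, mul_add θ, Real.sin_add]
    ring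
  -- measurability / integrability
  have hmM : ∀ k, Measurable fun B : Fin (n + 1) → ℝ => clM w σ2 x (finExt B) k := fun k => (measurable_clM_clA ρB w σ2 x k).1
  have hmA : ∀ k, Measurable fun B : Fin (n + 1) → ℝ => clA ρB w x (finExt B) k := fun k => (measurable_clM_clA ρB w σ2 x k).2
  have hmX : Measurable fun B : Fin (n + 1) → ℝ => X B l := measurable_ahPhase_pi w x l
  have hcInc : Continuous fun p : ℝ × ℝ => clInc w σ2 p.1 p.2 := by fun_prop
  have hcQ : Continuous fun y => clQ' ρB w y := by fun_prop
  have hmInc : Measurable fun B : Fin (n + 1) → ℝ => clInc w σ2 (X B l) (finExt B l) :=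
    hcInc.measurable.comp (hmX.prodMk (measurable_finExt l))
  have hmQ : Measurable fun B : Fin (n + 1) → ℝ => clQ' ρB w (X B l) := hcQ.measurable.comp hmX
  -- the integrand `G_c`, `G_s` after the step identity, and their integrability
  set Gc : (Fin (n + 1) → ℝ) → ℝ := fun B => Real.exp (θ ^ 2 * A B / 2) * (Real.cos (θ * M B) *
      (Real.exp (θ ^ 2 * clQ' ρB w (X B l) / 2) * Real.cos (θ * clInc w σ2 (X B l) (finExt B l)) - 1) -
      Real.sin (θ * M B) * (Real.exp (θ ^ 2 * clQ' ρB w (X B l) / 2) * Real.sin (θ * clInc w σ2 (X B l) (finExt B l))))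
    with hGc
  set Gs : (Fin (n + 1) → ℝ) → ℝ := fun B => Real.exp (θ ^ 2 * A B / 2) * (Real.sin (θ * M B) *
      (Real.exp (θ ^ 2 * clQ' ρB w (X B l) / 2) * Real.cos (θ * clInc w σ2 (X B l) (finExt B l)) - 1) +
      Real.cos (θ * M B) * (Real.exp (θ ^ 2 * clQ' ρB w (X B l) / 2) * Real.sin (θ * clInc w σ2 (X B l) (finExt B l))))
    with hGs
  have hmGc : Measurable Gc := by
    simp only [hGc, hA, hM]
    exact (Real.measurable_exp.comp ((measurable_const.mul (hmA l)).div_const _)).mul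
      (((Real.measurable_cos.comp (measurable_const.mul (hmM l))).mul
        (((Real.measurable_exp.comp ((measurable_const.mul hmQ).div_const _)).mul
          (Real.measurable_cos.comp (measurable_const.mul hmInc))).sub measurable_const)).sub
        ((Real.measurable_sin.comp (measurable_const.mul (hmM l))).mul
          ((Real.measurable_exp.comp ((measurable_const.mul hmQ).div_const _)).mul
            (Real.measurable_sin.comp (measurable_const.mul hmInc)))))
  have hmGs : Measurable Gs := by
    simp only [hGs, hA, hM]
    exact (Real.measurable_exp.comp ((measurable_const.mul (hmA l)).div_const _)).mul
      (((Real.measurable_sin.comp (measurable_const.mul (hmM l))).mul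
        (((Real.measurable_exp.comp ((measurable_const.mul hmQ).div_const _)).mul
          (Real.measurable_cos.comp (measurable_const.mul hmInc))).sub measurable_const)).add
        ((Real.measurable_cos.comp (measurable_const.mul (hmM l))).mul
          ((Real.measurable_exp.comp ((measurable_const.mul hmQ).div_const _)).mul
            (Real.measurable_sin.comp (measurable_const.mul hmInc)))))
  -- uniform bound of the one-step factors: `e^{u} ≤ 3`
  have heu : ∀ B, Real.exp (θ ^ 2 * clQ' ρB w (X B l) / 2) ≤ 3 := by
    intro B
    have := Real.exp_one_lt_d9
    calc Real.exp (θ ^ 2 * clQ' ρB w (X B l) / 2) ≤ Real.exp 1 := Real.exp_le_exp.mpr (hstep _).2.1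
      _ ≤ 3 := by linarith
  have hGcb : ∀ B, |Gc B| ≤ E * (1 * (3 * 1 + 1) + 1 * (3 * 1)) := by
    intro B
    simp only [hGc]
    rw [abs_mul, abs_of_pos (hexpA B).1]
    refine mul_le_mul (hexpA B).2 ?_ (abs_nonneg _) (by positivity)
    refine (abs_sub _ _).trans (add_le_add ?_ ?_)
    · rw [abs_mul]
      refine mul_le_mul (Real.abs_cos_le_one _) ((abs_sub _ _).trans (add_le_add ?_ (by simp))) (abs_nonneg _) zero_le_one
      rw [abs_mul, abs_of_pos (Real.exp_pos _)]
      exact mul_le_mul (heu B) (Real.abs_cos_le_one _) (abs_nonneg _) (by norm_num)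
    · rw [abs_mul]
      refine mul_le_mul (Real.abs_sin_le_one _) ?_ (abs_nonneg _) zero_le_one
      rw [abs_mul, abs_of_pos (Real.exp_pos _)]
      exact mul_le_mul (heu B) (Real.abs_sin_le_one _) (abs_nonneg _) (by norm_num)
  have hGsb : ∀ B, |Gs B| ≤ E * (1 * (3 * 1 + 1) + 1 * (3 * 1)) := by
    intro B
    simp only [hGs]
    rw [abs_mul, abs_of_pos (hexpA B).1]
    refine mul_le_mul (hexpA B).2 ?_ (abs_nonneg _) (by positivity)
    refine (abs_add_le _ _).trans (add_le_add ?_ ?_)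
    · rw [abs_mul]
      refine mul_le_mul (Real.abs_sin_le_one _) ((abs_sub _ _).trans (add_le_add ?_ (by simp))) (abs_nonneg _) zero_le_one
      rw [abs_mul, abs_of_pos (Real.exp_pos _)]
      exact mul_le_mul (heu B) (Real.abs_cos_le_one _) (abs_nonneg _) (by norm_num)
    · rw [abs_mul]
      refine mul_le_mul (Real.abs_cos_le_one _) ?_ (abs_nonneg _) zero_le_one
      rw [abs_mul, abs_of_pos (Real.exp_pos _)]
      exact mul_le_mul (heu B) (Real.abs_sin_le_one _) (abs_nonneg _) (by norm_num)
  have hIGc : Integrable Gc μ := Integrable.mono' (integrable_const _) hmGc.aestronglyMeasurable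
    (ae_of_all _ fun B => by rw [Real.norm_eq_abs]; exact hGcb B)
  have hIGs : Integrable Gs μ := Integrable.mono' (integrable_const _) hmGs.aestronglyMeasurable
    (ae_of_all _ fun B => by rw [Real.norm_eq_abs]; exact hGsb B)
  -- the inner integrals after resampling `B_l`
  set Ic : ℝ → ℝ := fun y => ∫ b, Real.cos (θ * clInc w σ2 y b) ∂ρB with hIc
  set Is : ℝ → ℝ := fun y => ∫ b, Real.sin (θ * clInc w σ2 y b) ∂ρB with hIs
  have hinner_c : ∀ B, ∫ b, Gc (update B lF b) ∂ρB = Real.exp (θ ^ 2 * A B / 2) * (Real.cos (θ * M B) *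
      (Real.exp (θ ^ 2 * clQ' ρB w (X B l) / 2) * Ic (X B l) - 1) -
      Real.sin (θ * M B) * (Real.exp (θ ^ 2 * clQ' ρB w (X B l) / 2) * Is (X B l))) := by
    intro B
    have hI1 : Integrable (fun b => Real.cos (θ * clInc w σ2 (X B l) b)) ρB :=
      integrable_rhoB_of_continuous hτ hρ (by fun_prop)
    have hI2 : Integrable (fun b => Real.sin (θ * clInc w σ2 (X B l) b)) ρB :=
      integrable_rhoB_of_continuous hτ hρ (by fun_prop)
    have e : ∀ b, Gc (update B lF b) = Real.exp (θ ^ 2 * A B / 2) * (Real.cos (θ * M B) *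
        (Real.exp (θ ^ 2 * clQ' ρB w (X B l) / 2) * Real.cos (θ * clInc w σ2 (X B l) b) - 1) -
        Real.sin (θ * M B) * (Real.exp (θ ^ 2 * clQ' ρB w (X B l) / 2) * Real.sin (θ * clInc w σ2 (X B l) b))) := by
      intro b
      obtain ⟨h1, h2, h3, h4⟩ := hupd B b
      simp only [hGc]
      rw [h1, h2, h3, h4]
    simp_rw [e]
    rw [integral_const_mul]
    congr 1
    have i1 : Integrable (fun b => Real.cos (θ * M B) *
        (Real.exp (θ ^ 2 * clQ' ρB w (X B l) / 2) * Real.cos (θ * clInc w σ2 (X B l) b) - 1)) ρB :=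
      ((hI1.const_mul _).sub (integrable_const _)).const_mul _
    have i2 : Integrable (fun b => Real.sin (θ * M B) *
        (Real.exp (θ ^ 2 * clQ' ρB w (X B l) / 2) * Real.sin (θ * clInc w σ2 (X B l) b))) ρB :=
      (hI2.const_mul _).const_mul _
    have i3 : Integrable (fun b => Real.exp (θ ^ 2 * clQ' ρB w (X B l) / 2) * Real.cos (θ * clInc w σ2 (X B l) b)) ρB :=
      hI1.const_mul _
    rw [integral_sub i1 i2, integral_const_mul, integral_const_mul, integral_sub i3 (integrable_const _),
      integral_const_mul, integral_const_mul, integral_const, probReal_univ, one_smul]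
  have hinner_s : ∀ B, ∫ b, Gs (update B lF b) ∂ρB = Real.exp (θ ^ 2 * A B / 2) * (Real.sin (θ * M B) *
      (Real.exp (θ ^ 2 * clQ' ρB w (X B l) / 2) * Ic (X B l) - 1) +
      Real.cos (θ * M B) * (Real.exp (θ ^ 2 * clQ' ρB w (X B l) / 2) * Is (X B l))) := by
    intro B
    have hI1 : Integrable (fun b => Real.cos (θ * clInc w σ2 (X B l) b)) ρB :=
      integrable_rhoB_of_continuous hτ hρ (by fun_prop)
    have hI2 : Integrable (fun b => Real.sin (θ * clInc w σ2 (X B l) b)) ρB :=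
      integrable_rhoB_of_continuous hτ hρ (by fun_prop)
    have e : ∀ b, Gs (update B lF b) = Real.exp (θ ^ 2 * A B / 2) * (Real.sin (θ * M B) *
        (Real.exp (θ ^ 2 * clQ' ρB w (X B l) / 2) * Real.cos (θ * clInc w σ2 (X B l) b) - 1) +
        Real.cos (θ * M B) * (Real.exp (θ ^ 2 * clQ' ρB w (X B l) / 2) * Real.sin (θ * clInc w σ2 (X B l) b))) := by
      intro b
      obtain ⟨h1, h2, h3, h4⟩ := hupd B b
      simp only [hGs]
      rw [h1, h2, h3, h4]
    simp_rw [e]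
    rw [integral_const_mul]
    congr 1
    have i1 : Integrable (fun b => Real.sin (θ * M B) *
        (Real.exp (θ ^ 2 * clQ' ρB w (X B l) / 2) * Real.cos (θ * clInc w σ2 (X B l) b) - 1)) ρB :=
      ((hI1.const_mul _).sub (integrable_const _)).const_mul _
    have i2 : Integrable (fun b => Real.cos (θ * M B) *
        (Real.exp (θ ^ 2 * clQ' ρB w (X B l) / 2) * Real.sin (θ * clInc w σ2 (X B l) b))) ρB :=
      (hI2.const_mul _).const_mul _
    have i3 : Integrable (fun b => Real.exp (θ ^ 2 * clQ' ρB w (X B l) / 2) * Real.cos (θ * clInc w σ2 (X B l) b)) ρB :=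
      hI1.const_mul _
    rw [integral_add i1 i2, integral_const_mul, integral_const_mul, integral_sub i3 (integrable_const _),
      integral_const_mul, integral_const_mul, integral_const, probReal_univ, one_smul]
  -- bounds of the inner integrals
  have hIcb : ∀ y, |Real.exp (θ ^ 2 * clQ' ρB w y / 2) * Ic y - 1| ≤ CA * w ^ 3 := fun y => (hstep y).2.2.1
  have hIsb : ∀ y, |Real.exp (θ ^ 2 * clQ' ρB w y / 2) * Is y| ≤ CA * w ^ 3 := fun y => (hstep y).2.2.2
  have hin_c : ∀ B, |∫ b, Gc (update B lF b) ∂ρB| ≤ E * (2 * (CA * w ^ 3)) := by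
    intro B
    rw [hinner_c B, abs_mul, abs_of_pos (hexpA B).1]
    refine mul_le_mul (hexpA B).2 ?_ (abs_nonneg _) (by positivity)
    refine (abs_sub _ _).trans ?_
    rw [abs_mul, abs_mul]
    have h1 := mul_le_mul (Real.abs_cos_le_one (θ * M B)) (hIcb (X B l)) (abs_nonneg _) zero_le_one
    have h2 := mul_le_mul (Real.abs_sin_le_one (θ * M B)) (hIsb (X B l)) (abs_nonneg _) zero_le_one
    linarith
  have hin_s : ∀ B, |∫ b, Gs (update B lF b) ∂ρB| ≤ E * (2 * (CA * w ^ 3)) := by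
    intro B
    rw [hinner_s B, abs_mul, abs_of_pos (hexpA B).1]
    refine mul_le_mul (hexpA B).2 ?_ (abs_nonneg _) (by positivity)
    refine (abs_add_le _ _).trans ?_
    rw [abs_mul, abs_mul]
    have h1 := mul_le_mul (Real.abs_sin_le_one (θ * M B)) (hIcb (X B l)) (abs_nonneg _) zero_le_one
    have h2 := mul_le_mul (Real.abs_cos_le_one (θ * M B)) (hIsb (X B l)) (abs_nonneg _) zero_le_one
    linarith
  -- assemble
  have hRc_int : ∀ k, Integrable (fun B : Fin (n + 1) → ℝ =>
      Real.exp (θ ^ 2 * clA ρB w x (finExt B) k / 2) * Real.cos (θ * clM w σ2 x (finExt B) k)) μ := by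
    intro k
    refine Integrable.mono' (integrable_const (Real.exp (θ ^ 2 * (k * (Cq * w ^ 2)) / 2)))
      ((Real.measurable_exp.comp ((measurable_const.mul (hmA k)).div_const _)).mul
        (Real.measurable_cos.comp (measurable_const.mul (hmM k)))).aestronglyMeasurable (ae_of_all _ fun B => ?_)
    rw [Real.norm_eq_abs, abs_mul, abs_of_pos (Real.exp_pos _)]
    refine (mul_le_of_le_one_right (Real.exp_pos _).le (Real.abs_cos_le_one _)).trans (Real.exp_le_exp.mpr ?_)
    obtain ⟨h0, h1⟩ := clA_bounds ρB hq x (finExt B) k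
    have := mul_le_mul_of_nonneg_left h1 (sq_nonneg θ)
    linarith
  have hRs_int : ∀ k, Integrable (fun B : Fin (n + 1) → ℝ =>
      Real.exp (θ ^ 2 * clA ρB w x (finExt B) k / 2) * Real.sin (θ * clM w σ2 x (finExt B) k)) μ := by
    intro k
    refine Integrable.mono' (integrable_const (Real.exp (θ ^ 2 * (k * (Cq * w ^ 2)) / 2)))
      ((Real.measurable_exp.comp ((measurable_const.mul (hmA k)).div_const _)).mul
        (Real.measurable_sin.comp (measurable_const.mul (hmM k)))).aestronglyMeasurable (ae_of_all _ fun B => ?_)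
    rw [Real.norm_eq_abs, abs_mul, abs_of_pos (Real.exp_pos _)]
    refine (mul_le_of_le_one_right (Real.exp_pos _).le (Real.abs_sin_le_one _)).trans (Real.exp_le_exp.mpr ?_)
    obtain ⟨h0, h1⟩ := clA_bounds ρB hq x (finExt B) k
    have := mul_le_mul_of_nonneg_left h1 (sq_nonneg θ)
    linarith
  have hE2 : E * (2 * (CA * w ^ 3)) = 2 * E * CA * w ^ 3 := by ring
  constructor
  · rw [← integral_sub (hRc_int (l + 1)) (hRc_int l)]
    have e : (fun B => Real.exp (θ ^ 2 * clA ρB w x (finExt B) (l + 1) / 2) * Real.cos (θ * clM w σ2 x (finExt B) (l + 1)) -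
        Real.exp (θ ^ 2 * clA ρB w x (finExt B) l / 2) * Real.cos (θ * clM w σ2 x (finExt B) l)) = Gc :=
      funext fun B => hstepc B
    rw [e, integral_pi_update ρB lF Gc hIGc]
    calc |∫ B, ∫ b, Gc (update B lF b) ∂ρB ∂μ| ≤ ∫ B, |∫ b, Gc (update B lF b) ∂ρB| ∂μ := abs_integral_le_integral_abs
      _ ≤ ∫ _B, E * (2 * (CA * w ^ 3)) ∂μ := by
          refine integral_mono_of_nonneg (ae_of_all _ fun B => abs_nonneg _) (integrable_const _)
            (ae_of_all _ fun B => hin_c B)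
      _ = 2 * E * CA * w ^ 3 := by rw [integral_const, probReal_univ, one_smul, hE2]
  · rw [← integral_sub (hRs_int (l + 1)) (hRs_int l)]
    have e : (fun B => Real.exp (θ ^ 2 * clA ρB w x (finExt B) (l + 1) / 2) * Real.sin (θ * clM w σ2 x (finExt B) (l + 1)) -
        Real.exp (θ ^ 2 * clA ρB w x (finExt B) l / 2) * Real.sin (θ * clM w σ2 x (finExt B) l)) = Gs :=
      funext fun B => hsteps B
    rw [e, integral_pi_update ρB lF Gs hIGs]
    calc |∫ B, ∫ b, Gs (update B lF b) ∂ρB ∂μ| ≤ ∫ B, |∫ b, Gs (update B lF b) ∂ρB| ∂μ := abs_integral_le_integral_abs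
      _ ≤ ∫ _B, E * (2 * (CA * w ^ 3)) ∂μ := by
          refine integral_mono_of_nonneg (ae_of_all _ fun B => abs_nonneg _) (integrable_const _)
            (ae_of_all _ fun B => hin_s B)
      _ = 2 * E * CA * w ^ 3 := by rw [integral_const, probReal_univ, one_smul, hE2]

/-- **The exponential martingale has mean `1 + 𝒪(w)`**: `|𝔼 e^{θ²A_N/2}cos θM_N - 1| ≤ 2e^{Θ²C_q/2}C_A w`
and `|𝔼 e^{θ²A_N/2} sin θM_N| ≤ 2e^{Θ²C_q/2}C_A w` for `w²N ≤ 1`. [folklore] -/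
theorem peel_all (hτ : ReducedLawHyp τ bm bp) {ρB : Measure ℝ} [IsProbabilityMeasure ρB]
    (hρ : ρB = volume.withDensity fun s => ENNReal.ofReal (τ s)) {Θ w θ Cq CA : ℝ} (hw0 : 0 < w) (hCA : 0 ≤ CA)
    (hstep : ∀ y : ℝ, (0 ≤ clQ' ρB w y ∧ clQ' ρB w y ≤ Cq * w ^ 2) ∧ θ ^ 2 * clQ' ρB w y / 2 ≤ 1 ∧
      |Real.exp (θ ^ 2 * clQ' ρB w y / 2) * (∫ b, Real.cos (θ * clInc w (bM2 ρB) y b) ∂ρB) - 1| ≤ CA * w ^ 3 ∧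
      |Real.exp (θ ^ 2 * clQ' ρB w y / 2) * (∫ b, Real.sin (θ * clInc w (bM2 ρB) y b) ∂ρB)| ≤ CA * w ^ 3)
    (hθ : |θ| ≤ Θ) (x : ℝ) {N : ℕ} (hN : w ^ 2 * N ≤ 1) :
    |∫ B, Real.exp (θ ^ 2 * clA ρB w x (finExt B) N / 2) * Real.cos (θ * clM w (bM2 ρB) x (finExt B) N)
        ∂(Measure.pi fun _ : Fin N => ρB) - 1| ≤ 2 * Real.exp (Θ ^ 2 * Cq / 2) * CA * w ∧
    |∫ B, Real.exp (θ ^ 2 * clA ρB w x (finExt B) N / 2) * Real.sin (θ * clM w (bM2 ρB) x (finExt B) N)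
        ∂(Measure.pi fun _ : Fin N => ρB)| ≤ 2 * Real.exp (Θ ^ 2 * Cq / 2) * CA * w := by
  set μ := (Measure.pi fun _ : Fin N => ρB) with hμ
  set K : ℝ := 2 * Real.exp (Θ ^ 2 * Cq / 2) * CA * w ^ 3 with hK
  have hK0 : 0 ≤ K := by positivity
  set Rc : ℕ → ℝ := fun l => ∫ B, Real.exp (θ ^ 2 * clA ρB w x (finExt B) l / 2) *
    Real.cos (θ * clM w (bM2 ρB) x (finExt B) l) ∂μ with hRc
  set Rs : ℕ → ℝ := fun l => ∫ B, Real.exp (θ ^ 2 * clA ρB w x (finExt B) l / 2) *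
    Real.sin (θ * clM w (bM2 ρB) x (finExt B) l) ∂μ with hRs
  have hind : ∀ l, l ≤ N → |Rc l - 1| ≤ l * K ∧ |Rs l| ≤ l * K := by
    intro l
    induction l with
    | zero =>
      intro _
      simp only [hRc, hRs, clA, clM, Finset.range_zero, Finset.sum_empty, mul_zero, zero_div, Real.exp_zero,
        Real.cos_zero, Real.sin_zero, mul_one, integral_const, probReal_univ, smul_eq_mul, sub_self, abs_zero,
        Nat.cast_zero, zero_mul, le_refl, and_self]
    | succ l ih =>
      intro hl
      obtain ⟨ihc, ihs⟩ := ih (Nat.le_of_succ_le hl)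
      obtain ⟨hc, hs⟩ := peel_step hτ hρ hw0 hstep hθ x hN (Nat.lt_of_succ_le hl)
      constructor
      · have : |Rc (l + 1) - Rc l| ≤ K := hc
        have h2 := abs_sub_le (Rc (l + 1)) (Rc l) 1
        push_cast
        linarith
      · have : |Rs (l + 1) - Rs l| ≤ K := hs
        have h2 := abs_sub_abs_le_abs_sub (Rs (l + 1)) (Rs l)
        push_cast
        linarith
  obtain ⟨h1, h2⟩ := hind N le_rfl
  have hNK : (N : ℝ) * K ≤ 2 * Real.exp (Θ ^ 2 * Cq / 2) * CA * w := by
    rw [hK]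
    have e : (N : ℝ) * (2 * Real.exp (Θ ^ 2 * Cq / 2) * CA * w ^ 3) =
        (2 * Real.exp (Θ ^ 2 * Cq / 2) * CA * w) * (w ^ 2 * N) := by ring
    rw [e]
    exact mul_le_of_le_one_right (by positivity) hN
  exact ⟨h1.trans hNK, h2.trans hNK⟩

/-! ### First absolute moments of the two ergodic sums -/

/-- **`𝔼|w∑_{l<N}(s² - 3/8)(X_l)|` and `𝔼|w∑_{l<N} h₂(X_l)|` are bounded** (uniformly in `x`, `N` with
`w²N ≤ 1`, `w ≤ w₁ ≤ 1`). [folklore] -/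
theorem abs_moment_wsums_le (hτ : ReducedLawHyp τ bm bp) {ρB : Measure ℝ} [IsProbabilityMeasure ρB]
    (hρ : ρB = volume.withDensity fun s => ENNReal.ofReal (τ s)) {w₁ CΔ C₂ C₃ : ℝ} (hw₁ : w₁ ≤ 1)
    (hC₂ : 0 ≤ C₂)
    (hcc : ∀ w ∈ Set.Ioc 0 w₁, |ahTheta w - w| ≤ w ^ 3 ∧ ∀ y : ℝ, ∀ b ∈ Set.Icc bm bp,
      (0 ≤ ahStep w b y - y ∧ ahStep w b y - y ≤ CΔ * w) ∧
      |ahPhi w y b - w * b * clS y| ≤ C₂ * w ^ 2 ∧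
      |ahPhi w y b - (w * b * clS y + w ^ 2 * b ^ 2 * (π / 2) * clH y)| ≤ C₃ * w ^ 3)
    {w : ℝ} (hw : w ∈ Set.Ioc 0 w₁) (x : ℝ) {N : ℕ} (hN : w ^ 2 * N ≤ 1) :
    (Integrable (fun B : Fin N → ℝ => w * ∑ l ∈ Finset.range N, (clS (ahPhase w x (finExt B) l) ^ 2 - 3 / 8))
        (Measure.pi fun _ : Fin N => ρB) ∧
      ∫ B, |w * ∑ l ∈ Finset.range N, (clS (ahPhase w x (finExt B) l) ^ 2 - 3 / 8)| ∂(Measure.pi fun _ : Fin N => ρB) ≤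
        (1 + (2 * (3 + 3 * π * CΔ ^ 2 + C₂) ^ 2 + 2 * bM2 ρB)) / 2) ∧
    (Integrable (fun B : Fin N → ℝ => w * ∑ l ∈ Finset.range N, clH (ahPhase w x (finExt B) l))
        (Measure.pi fun _ : Fin N => ρB) ∧
      ∫ B, |w * ∑ l ∈ Finset.range N, clH (ahPhase w x (finExt B) l)| ∂(Measure.pi fun _ : Fin N => ρB) ≤
        (1 + (2 * (3 + 3 * π * CΔ ^ 2 + C₂) ^ 2 + 2 * bM2 ρB)) / 2) := by
  set μ := (Measure.pi fun _ : Fin N => ρB) with hμ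
  have hw0 : 0 < w := hw.1
  have hw1 : w ≤ 1 := hw.2.trans hw₁
  have hσ0 : 0 ≤ bM2 ρB := integral_nonneg fun b => sq_nonneg b
  -- the common bound on the `L²` constant
  have hKle : ∀ L : ℝ, 0 ≤ L → L ≤ 3 * π →
      2 * (2 + L * N * (CΔ * w) ^ 2 + N * (w ^ 3 + C₂ * w ^ 2)) ^ 2 + 2 * (∫ b, b ^ 2 ∂ρB) * (w ^ 2 * N) ≤
        2 * (3 + 3 * π * CΔ ^ 2 + C₂) ^ 2 + 2 * bM2 ρB := by
    intro L hL0 hL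
    have hNw : (N : ℝ) * w ^ 2 ≤ 1 := by linarith
    have hN0 : (0 : ℝ) ≤ N := Nat.cast_nonneg N
    have h1 : L * N * (CΔ * w) ^ 2 ≤ 3 * π * CΔ ^ 2 := by
      calc L * N * (CΔ * w) ^ 2 = (L * CΔ ^ 2) * (N * w ^ 2) := by ring
        _ ≤ (3 * π * CΔ ^ 2) * 1 := mul_le_mul (mul_le_mul_of_nonneg_right hL (sq_nonneg _)) hNw (by positivity) (by positivity)
        _ = 3 * π * CΔ ^ 2 := mul_one _
    have h2 : (N : ℝ) * (w ^ 3 + C₂ * w ^ 2) ≤ 1 + C₂ := by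
      have e : (N : ℝ) * (w ^ 3 + C₂ * w ^ 2) = (N * w ^ 2) * w + C₂ * (N * w ^ 2) := by ring
      rw [e]
      have a1 : (N : ℝ) * w ^ 2 * w ≤ 1 * 1 := mul_le_mul hNw hw1 hw0.le zero_le_one
      have a2 : C₂ * ((N : ℝ) * w ^ 2) ≤ C₂ * 1 := mul_le_mul_of_nonneg_left hNw hC₂
      linarith
    have hin0 : 0 ≤ 2 + L * N * (CΔ * w) ^ 2 + N * (w ^ 3 + C₂ * w ^ 2) := by positivity
    have hin : 2 + L * N * (CΔ * w) ^ 2 + N * (w ^ 3 + C₂ * w ^ 2) ≤ 3 + 3 * π * CΔ ^ 2 + C₂ := by linarith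
    have h3 := pow_le_pow_left₀ hin0 hin 2
    have h4 : (∫ b, b ^ 2 ∂ρB) * (w ^ 2 * N) ≤ bM2 ρB := by
      show bM2 ρB * (w ^ 2 * N) ≤ bM2 ρB
      exact mul_le_of_le_one_right hσ0 hN
    linarith
  -- from `L²` to `L¹`
  have hL1 : ∀ (S : (Fin N → ℝ) → ℝ) (K : ℝ), Integrable (fun B => S B ^ 2) μ → Measurable S →
      ∫ B, S B ^ 2 ∂μ ≤ K → Integrable S μ ∧ ∫ B, |S B| ∂μ ≤ (1 + K) / 2 := by
    intro S K hS2 hSm hK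
    have hIS : Integrable S μ := by
      refine Integrable.mono' ((integrable_const 1).add hS2 |>.div_const 2) hSm.aestronglyMeasurable
        (ae_of_all _ fun B => ?_)
      rw [Real.norm_eq_abs]
      exact abs_le_half_one_add_sq (S B)
    refine ⟨hIS, ?_⟩
    calc ∫ B, |S B| ∂μ ≤ ∫ B, (1 + S B ^ 2) / 2 ∂μ :=
          integral_mono hIS.abs ((integrable_const 1).add hS2 |>.div_const 2) fun B => abs_le_half_one_add_sq (S B)
      _ = (1 + ∫ B, S B ^ 2 ∂μ) / 2 := by
          rw [integral_div, integral_add (integrable_const _) hS2, integral_const, probReal_univ, one_smul]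
      _ ≤ (1 + K) / 2 := by linarith
  have hXm : ∀ k : ℕ, Measurable fun B : Fin N → ℝ => ahPhase w x (finExt B) k := measurable_ahPhase_pi w x
  constructor
  · have hg1 : ∀ y, |clS y ^ 2 - 3 / 8| ≤ 1 := fun y => by
      have h := clS_mem y
      have : clS y ^ 2 ≤ 1 := pow_le_one₀ h.1 h.2
      rw [abs_le]; constructor <;> nlinarith [sq_nonneg (clS y)]
    obtain ⟨hI, hle⟩ := integral_sq_wsum_le hτ hρ hcc hasDerivAt_clP1 (by fun_prop) hg1 abs_clP1_le
      abs_clS_sq_sub_le hw x N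
    have hb := hle.trans (hKle (2 * π) (by positivity) (by linarith [Real.pi_pos]))
    exact hL1 _ _ hI (measurable_const.mul (Finset.measurable_sum _ fun l _ =>
      ((continuous_clS_comp continuous_id).measurable.comp (hXm l)).pow_const 2 |>.sub_const _)) hb
  · obtain ⟨hI, hle⟩ := integral_sq_wsum_le hτ hρ hcc hasDerivAt_clP2 (by fun_prop) abs_clH_le abs_clP2_le
      abs_clH_sub_le hw x N
    have hb := hle.trans (hKle (3 * π) (by positivity) le_rfl)
    exact hL1 _ _ hI (measurable_const.mul (Finset.measurable_sum _ fun l _ =>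
      (continuous_clH_comp continuous_id).measurable.comp (hXm l))) hb

/-! ### The low-frequency CLT -/

/-- `cos` and `sin` are `1`-Lipschitz. [folklore] -/
theorem abs_cos_sub_cos_le' (a b : ℝ) : |Real.cos a - Real.cos b| ≤ |a - b| := by
  have := abs_sub_le_of_hasDerivAt (f := Real.cos) (f' := fun y => -Real.sin y) (fun y => Real.hasDerivAt_cos y)
    (C := 1) (fun y => by rw [abs_neg]; exact Real.abs_sin_le_one y) a b
  simpa using this

/-- `sin` is `1`-Lipschitz. [folklore] -/
theorem abs_sin_sub_sin_le' (a b : ℝ) : |Real.sin a - Real.sin b| ≤ |a - b| := by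
  have := abs_sub_le_of_hasDerivAt (f := Real.sin) (f' := fun y => Real.cos y) (fun y => Real.hasDerivAt_sin y)
    (C := 1) (fun y => Real.abs_cos_le_one y) a b
  simpa using this

set_option maxHeartbeats 3200000 in
/-- **Low-frequency CLT for the critical-band chain (`h ≡ 0`)**: for every `Θ` there are `C, w₀`
such that for `0 < w ≤ w₀`, `|θ| ≤ Θ`, every start `x` and every `N` with `w²N ≤ 1`,
`|𝔼 cos θX^x_N - e^{-θ²V_N/2} cos θ(x + Nϑ)| ≤ Cw` and `|𝔼 sin θX^x_N - e^{-θ²V_N/2} sin θ(x + Nϑ)| ≤ Cw`,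
`V_N = (3/8) σ̂² w² N`, `σ̂² = ∫ b² ρ_B(db)`. [cite: AjankiHuveneers2011, App. 7.3 (Gaussian limit of
the kernel, through Lemma 3.2 (3.11)); folklore (martingale CLT)] -/
theorem clt_low_frequency (hτ : ReducedLawHyp τ bm bp) (ρB : Measure ℝ) [IsProbabilityMeasure ρB]
    (hρ : ρB = volume.withDensity fun s => ENNReal.ofReal (τ s)) {Θ : ℝ} (hΘ : 0 ≤ Θ) :
    ∃ C w₀ : ℝ, 0 < w₀ ∧ ∀ w ∈ Set.Ioc 0 w₀, ∀ θ : ℝ, |θ| ≤ Θ → ∀ x : ℝ, ∀ N : ℕ, w ^ 2 * N ≤ 1 →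
      |∫ B, Real.cos (θ * ahPhase w x (finExt B) N) ∂(Measure.pi fun _ : Fin N => ρB) -
          Real.exp (-(θ ^ 2 * (3 / 8 * bM2 ρB * w ^ 2 * N) / 2)) * Real.cos (θ * (x + N * ahTheta w))| ≤ C * w ∧
      |∫ B, Real.sin (θ * ahPhase w x (finExt B) N) ∂(Measure.pi fun _ : Fin N => ρB) -
          Real.exp (-(θ ^ 2 * (3 / 8 * bM2 ρB * w ^ 2 * N) / 2)) * Real.sin (θ * (x + N * ahTheta w))| ≤ C * w := by
  obtain ⟨w₁, CΔ, C₂, C₃, hw₁0, hw₁1, hCΔ0, hC₂0, hC₃0, hcc⟩ := chain_consts hτ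
  obtain ⟨wA, Cq, CA, hwA0, hwA1, hCq0, hCA0, hst⟩ := one_step_trig hτ hρ hΘ
  set σ2 : ℝ := bM2 ρB with hσ2
  have hσ0 : 0 ≤ σ2 := integral_nonneg fun b => sq_nonneg b
  set KK : ℝ := (1 + (2 * (3 + 3 * π * CΔ ^ 2 + C₂) ^ 2 + 2 * σ2)) / 2 with hKK
  have hKK0 : 0 ≤ KK := by positivity
  set E : ℝ := Real.exp (Θ ^ 2 * Cq / 2) with hE
  set Cr : ℝ := π * |bK3 ρB| + π ^ 2 / 4 * bK4 ρB with hCr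
  have hκ40 : 0 ≤ bK4 ρB := integral_nonneg fun b => sq_nonneg _
  have hCr0 : 0 ≤ Cr := by positivity
  set cV : ℝ := Cr + σ2 * KK with hcV
  set C : ℝ := Θ * (σ2 * (π / 2) * KK + C₃) + 2 * (E * (Θ ^ 2 / 2) * cV + 2 * E * CA) with hC
  refine ⟨C, min w₁ wA, lt_min hw₁0 hwA0, ?_⟩
  intro w hw θ hθ x N hN
  have hw0 : 0 < w := hw.1
  have hww₁ : w ∈ Set.Ioc 0 w₁ := ⟨hw0, hw.2.trans (min_le_left _ _)⟩
  have hwwA : w ∈ Set.Ioc 0 wA := ⟨hw0, hw.2.trans (min_le_right _ _)⟩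
  have hw1 : w ≤ 1 := hwwA.2.trans hwA1
  have hstep := hst w hwwA θ hθ
  have hθ2 : θ ^ 2 ≤ Θ ^ 2 := by rw [← sq_abs]; exact pow_le_pow_left₀ (abs_nonneg _) hθ 2
  set μ := (Measure.pi fun _ : Fin N => ρB) with hμ
  -- notation
  set X : (Fin N → ℝ) → ℕ → ℝ := fun B k => ahPhase w x (finExt B) k with hX
  set MN : (Fin N → ℝ) → ℝ := fun B => clM w σ2 x (finExt B) N with hMN
  set AN : (Fin N → ℝ) → ℝ := fun B => clA ρB w x (finExt B) N with hAN
  set S1 : (Fin N → ℝ) → ℝ := fun B => w * ∑ l ∈ Finset.range N, (clS (X B l) ^ 2 - 3 / 8) with hS1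
  set S2 : (Fin N → ℝ) → ℝ := fun B => w * ∑ l ∈ Finset.range N, clH (X B l) with hS2
  set DN : (Fin N → ℝ) → ℝ := fun B => w * σ2 * (π / 2) * S2 B with hDN
  set V : ℝ := 3 / 8 * σ2 * w ^ 2 * N with hV
  have hV0 : 0 ≤ V := by positivity
  set a : ℝ := x + N * ahTheta w with ha
  have hNw3 : (N : ℝ) * w ^ 3 ≤ w := by
    calc (N : ℝ) * w ^ 3 = (w ^ 2 * N) * w := by ring
      _ ≤ 1 * w := mul_le_mul_of_nonneg_right hN hw0.le
      _ = w := one_mul _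
  -- measurability and a generic integrability device
  have hXm : ∀ k : ℕ, Measurable fun B : Fin N → ℝ => X B k := measurable_ahPhase_pi w x
  have hMm : Measurable MN := (measurable_clM_clA ρB w σ2 x N).1
  have hAm : Measurable AN := (measurable_clM_clA ρB w σ2 x N).2
  have hbint : ∀ f : (Fin N → ℝ) → ℝ, Measurable f → ∀ K : ℝ, (∀ B, |f B| ≤ K) → Integrable f μ :=
    fun f hf K hK => Integrable.mono' (integrable_const K) hf.aestronglyMeasurable
      (ae_of_all _ fun B => by rw [Real.norm_eq_abs]; exact hK B)
  have hae := ae_pi_mem_Icc hτ.eq_zero hρ N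
  have hsupp : ∀ B : Fin N → ℝ, (∀ i, bm ≤ B i ∧ B i ≤ bp) → ∀ k, finExt B k ∈ Set.Icc bm bp := by
    intro B hB k
    by_cases hk : k < N
    · rw [finExt_of_lt _ hk]; exact ⟨(hB _).1, (hB _).2⟩
    · simp only [finExt, hk, ↓reduceDIte]; exact ⟨hτ.bm_nonpos, hτ.bp_nonneg⟩
  -- (F1) pathwise: `X_N = a + M_N + D_N + 𝒪(C₃ w)`
  have hF1 : ∀ᵐ B ∂μ, |X B N - a - MN B - DN B| ≤ C₃ * w := by
    filter_upwards [hae] with B hB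
    have hrep : X B N - a - MN B - DN B = ∑ l ∈ Finset.range N,
        (ahPhi w (X B l) (finExt B l) - (w * finExt B l * clS (X B l) + w ^ 2 * finExt B l ^ 2 * (π / 2) * clH (X B l))) := by
      have e1 : X B N = x + N * ahTheta w + ∑ l ∈ Finset.range N, ahPhi w (X B l) (finExt B l) := ahPhase_eq_sum w x _ N
      have e2 : MN B + DN B = ∑ l ∈ Finset.range N, (clInc w σ2 (X B l) (finExt B l) + w ^ 2 * σ2 * (π / 2) * clH (X B l)) := by
        simp only [hMN, hDN, hS2, clM, hX]
        rw [Finset.sum_add_distrib, Finset.mul_sum, Finset.mul_sum]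
        congr 1
        refine Finset.sum_congr rfl fun l _ => ?_
        ring
      have e3 : ∀ l, clInc w σ2 (X B l) (finExt B l) + w ^ 2 * σ2 * (π / 2) * clH (X B l) =
          w * finExt B l * clS (X B l) + w ^ 2 * finExt B l ^ 2 * (π / 2) * clH (X B l) := by
        intro l; unfold clInc; ring
      simp_rw [e3] at e2
      rw [show X B N - a - MN B - DN B = X B N - a - (MN B + DN B) by ring, e2, e1, ha, Finset.sum_sub_distrib]
      ring
    rw [hrep]
    calc |∑ l ∈ Finset.range N, (ahPhi w (X B l) (finExt B l) -
          (w * finExt B l * clS (X B l) + w ^ 2 * finExt B l ^ 2 * (π / 2) * clH (X B l)))|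
        ≤ ∑ l ∈ Finset.range N, |ahPhi w (X B l) (finExt B l) -
          (w * finExt B l * clS (X B l) + w ^ 2 * finExt B l ^ 2 * (π / 2) * clH (X B l))| := Finset.abs_sum_le_sum_abs _ _
      _ ≤ ∑ _l ∈ Finset.range N, C₃ * w ^ 3 := Finset.sum_le_sum fun l _ => ((hcc w hww₁).2 _ _ (hsupp B hB l)).2.2
      _ = N * (C₃ * w ^ 3) := by rw [Finset.sum_const, Finset.card_range, nsmul_eq_mul]
      _ = C₃ * (N * w ^ 3) := by ring
      _ ≤ C₃ * w := mul_le_mul_of_nonneg_left hNw3 hC₃0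
  -- (F2) the two ergodic sums
  obtain ⟨⟨hIS1, hS1le⟩, ⟨hIS2, hS2le⟩⟩ := abs_moment_wsums_le hτ hρ hw₁1 hC₂0 hcc hww₁ x hN
  have hS1le' : ∫ B, |S1 B| ∂μ ≤ KK := hS1le
  have hS2le' : ∫ B, |S2 B| ∂μ ≤ KK := hS2le
  -- (F3) `𝔼|A_N - V| ≤ cV w`
  have hq : ∀ y, 0 ≤ clQ' ρB w y ∧ clQ' ρB w y ≤ Cq * w ^ 2 := fun y => (hstep y).1
  have hqdev : ∀ y, |clQ' ρB w y - w ^ 2 * σ2 * clS y ^ 2| ≤ Cr * w ^ 3 := by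
    intro y
    have hs := clS_mem y
    have hH := abs_clH_le y
    have e : clQ' ρB w y - w ^ 2 * σ2 * clS y ^ 2 =
        w ^ 3 * π * bK3 ρB * (clS y * clH y) + w ^ 4 * (π ^ 2 / 4) * bK4 ρB * clH y ^ 2 := by
      show clQ w (bM2 ρB) (bK3 ρB) (bK4 ρB) y - w ^ 2 * σ2 * clS y ^ 2 = _
      unfold clQ; rw [hσ2]; ring
    rw [e]
    have hsh : |clS y * clH y| ≤ 1 := by
      rw [abs_mul, abs_of_nonneg hs.1]; exact mul_le_one₀ hs.2 (abs_nonneg _) hH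
    have hh2 : clH y ^ 2 ≤ 1 := by rw [← sq_abs]; exact pow_le_one₀ (abs_nonneg _) hH
    have h1 : |w ^ 3 * π * bK3 ρB * (clS y * clH y)| ≤ w ^ 3 * (π * |bK3 ρB|) := by
      rw [abs_mul, abs_mul, abs_mul, abs_of_pos (pow_pos hw0 3), abs_of_pos Real.pi_pos]
      calc w ^ 3 * π * |bK3 ρB| * |clS y * clH y| ≤ w ^ 3 * π * |bK3 ρB| * 1 :=
            mul_le_mul_of_nonneg_left hsh (by positivity)
        _ = w ^ 3 * (π * |bK3 ρB|) := by ring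
    have h2 : |w ^ 4 * (π ^ 2 / 4) * bK4 ρB * clH y ^ 2| ≤ w ^ 3 * (π ^ 2 / 4 * bK4 ρB) := by
      rw [abs_of_nonneg (by positivity)]
      have hw43 : w ^ 4 ≤ w ^ 3 := by nlinarith only [hw0, hw1, pow_pos hw0 3]
      calc w ^ 4 * (π ^ 2 / 4) * bK4 ρB * clH y ^ 2 ≤ w ^ 4 * (π ^ 2 / 4) * bK4 ρB * 1 :=
            mul_le_mul_of_nonneg_left hh2 (by positivity)
        _ = w ^ 4 * (π ^ 2 / 4 * bK4 ρB) := by ring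
        _ ≤ w ^ 3 * (π ^ 2 / 4 * bK4 ρB) := mul_le_mul_of_nonneg_right hw43 (by positivity)
    calc _ ≤ w ^ 3 * (π * |bK3 ρB|) + w ^ 3 * (π ^ 2 / 4 * bK4 ρB) := (abs_add_le _ _).trans (add_le_add h1 h2)
      _ = Cr * w ^ 3 := by rw [hCr]; ring
  have hAVpt : ∀ B, |AN B - V| ≤ Cr * w + w * σ2 * |S1 B| := by
    intro B
    have e : AN B - V = ∑ l ∈ Finset.range N, (clQ' ρB w (X B l) - w ^ 2 * σ2 * clS (X B l) ^ 2) + w * σ2 * S1 B := by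
      simp only [hAN, hS1, clA, hV, hX]
      rw [Finset.mul_sum, Finset.mul_sum, ← Finset.sum_add_distrib]
      have : (3 / 8 * σ2 * w ^ 2 * N : ℝ) = ∑ _l ∈ Finset.range N, 3 / 8 * σ2 * w ^ 2 := by
        rw [Finset.sum_const, Finset.card_range, nsmul_eq_mul]; ring
      rw [this, ← Finset.sum_sub_distrib]
      refine Finset.sum_congr rfl fun l _ => ?_
      ring
    rw [e]
    refine (abs_add_le _ _).trans (add_le_add ?_ ?_)
    · calc |∑ l ∈ Finset.range N, (clQ' ρB w (X B l) - w ^ 2 * σ2 * clS (X B l) ^ 2)|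
          ≤ ∑ l ∈ Finset.range N, |clQ' ρB w (X B l) - w ^ 2 * σ2 * clS (X B l) ^ 2| := Finset.abs_sum_le_sum_abs _ _
        _ ≤ ∑ _l ∈ Finset.range N, Cr * w ^ 3 := Finset.sum_le_sum fun l _ => hqdev _
        _ = Cr * (N * w ^ 3) := by rw [Finset.sum_const, Finset.card_range, nsmul_eq_mul]; ring
        _ ≤ Cr * w := mul_le_mul_of_nonneg_left hNw3 hCr0
    · rw [abs_mul, abs_of_nonneg (by positivity : (0:ℝ) ≤ w * σ2)]
  have hIAV : Integrable (fun B => |AN B - V|) μ := ((hAm.sub_const V).abs).aestronglyMeasurable |>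
    fun hm => Integrable.mono' ((integrable_const (Cr * w)).add ((hIS1.abs).const_mul (w * σ2))) hm
      (ae_of_all _ fun B => by rw [Real.norm_eq_abs, abs_abs]; exact hAVpt B)
  have hAV : ∫ B, |AN B - V| ∂μ ≤ cV * w := by
    calc ∫ B, |AN B - V| ∂μ ≤ ∫ B, (Cr * w + w * σ2 * |S1 B|) ∂μ :=
          integral_mono hIAV ((integrable_const (Cr * w)).add ((hIS1.abs).const_mul (w * σ2))) hAVpt
      _ = Cr * w + w * σ2 * ∫ B, |S1 B| ∂μ := by
          rw [integral_add (integrable_const _) ((hIS1.abs).const_mul _), integral_const, probReal_univ, one_smul,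
            integral_const_mul]
      _ ≤ Cr * w + w * σ2 * KK := by
          have := mul_le_mul_of_nonneg_left hS1le' (by positivity : (0:ℝ) ≤ w * σ2); linarith only [this]
      _ = cV * w := by rw [hcV]; ring
  -- (F4) the exponential martingale
  obtain ⟨hRc, hRs⟩ := peel_all hτ hρ hw0 hCA0 hstep hθ x hN
  -- (F5)/(F6) the characteristic function of `M_N`
  have hexpA : ∀ B, 0 < Real.exp (θ ^ 2 * AN B / 2) ∧ Real.exp (θ ^ 2 * AN B / 2) ≤ E := by
    intro B
    refine ⟨Real.exp_pos _, Real.exp_le_exp.mpr ?_⟩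
    obtain ⟨h0, h1⟩ := clA_bounds ρB hq x (finExt B) N
    have hA1 : AN B ≤ Cq := by
      refine h1.trans ?_
      calc (N : ℝ) * (Cq * w ^ 2) = Cq * (w ^ 2 * N) := by ring
        _ ≤ Cq * 1 := mul_le_mul_of_nonneg_left hN hCq0
        _ = Cq := mul_one _
    have := mul_le_mul hθ2 hA1 h0 (sq_nonneg Θ)
    linarith only [this]
  have hA0 : ∀ B, 0 ≤ AN B := fun B => (clA_bounds ρB hq x (finExt B) N).1
  have hdexp : ∀ B, |Real.exp (-(θ ^ 2 * AN B / 2)) - Real.exp (-(θ ^ 2 * V / 2))| ≤ Θ ^ 2 / 2 * |AN B - V| := by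
    intro B
    refine (abs_exp_neg_sub_exp_neg_le (by have := hA0 B; positivity) (by positivity)).trans ?_
    rw [show θ ^ 2 * AN B / 2 - θ ^ 2 * V / 2 = θ ^ 2 / 2 * (AN B - V) by ring, abs_mul,
      abs_of_nonneg (by positivity : (0:ℝ) ≤ θ ^ 2 / 2)]
    exact mul_le_mul_of_nonneg_right (by linarith only [hθ2]) (abs_nonneg _)
  set RcN : (Fin N → ℝ) → ℝ := fun B => Real.exp (θ ^ 2 * AN B / 2) * Real.cos (θ * MN B) with hRcN
  set RsN : (Fin N → ℝ) → ℝ := fun B => Real.exp (θ ^ 2 * AN B / 2) * Real.sin (θ * MN B) with hRsN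
  have hRcm : Measurable RcN := (Real.measurable_exp.comp ((measurable_const.mul hAm).div_const _)).mul
    (Real.measurable_cos.comp (measurable_const.mul hMm))
  have hRsm : Measurable RsN := (Real.measurable_exp.comp ((measurable_const.mul hAm).div_const _)).mul
    (Real.measurable_sin.comp (measurable_const.mul hMm))
  have hRcb : ∀ B, |RcN B| ≤ E := fun B => by
    simp only [hRcN]; rw [abs_mul, abs_of_pos (hexpA B).1]
    exact (mul_le_of_le_one_right (hexpA B).1.le (Real.abs_cos_le_one _)).trans (hexpA B).2
  have hRsb : ∀ B, |RsN B| ≤ E := fun B => by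
    simp only [hRsN]; rw [abs_mul, abs_of_pos (hexpA B).1]
    exact (mul_le_of_le_one_right (hexpA B).1.le (Real.abs_sin_le_one _)).trans (hexpA B).2
  have hdm : Measurable fun B => Real.exp (-(θ ^ 2 * AN B / 2)) - Real.exp (-(θ ^ 2 * V / 2)) :=
    (Real.measurable_exp.comp ((measurable_const.mul hAm).div_const _).neg).sub measurable_const
  have hdb : ∀ B, |Real.exp (-(θ ^ 2 * AN B / 2)) - Real.exp (-(θ ^ 2 * V / 2))| ≤ 2 := fun B => by
    have h1 : Real.exp (-(θ ^ 2 * AN B / 2)) ≤ 1 := Real.exp_le_one_iff.mpr (by have := hA0 B; nlinarith [sq_nonneg θ])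
    have h2 : Real.exp (-(θ ^ 2 * V / 2)) ≤ 1 := Real.exp_le_one_iff.mpr (by nlinarith [sq_nonneg θ])
    rw [abs_le]; constructor <;> linarith [Real.exp_pos (-(θ ^ 2 * AN B / 2)), Real.exp_pos (-(θ ^ 2 * V / 2))]
  have hcosM : |∫ B, Real.cos (θ * MN B) ∂μ - Real.exp (-(θ ^ 2 * V / 2))| ≤ E * (Θ ^ 2 / 2) * (cV * w) + 2 * E * CA * w := by
    have e1 : ∀ B, Real.cos (θ * MN B) = RcN B * (Real.exp (-(θ ^ 2 * AN B / 2)) - Real.exp (-(θ ^ 2 * V / 2))) +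
        Real.exp (-(θ ^ 2 * V / 2)) * RcN B := by
      intro B
      simp only [hRcN]
      have : Real.exp (θ ^ 2 * AN B / 2) * Real.exp (-(θ ^ 2 * AN B / 2)) = 1 := by
        rw [← Real.exp_add, add_neg_cancel, Real.exp_zero]
      linear_combination (-(Real.cos (θ * MN B))) * this
    have hI1 : Integrable (fun B => RcN B * (Real.exp (-(θ ^ 2 * AN B / 2)) - Real.exp (-(θ ^ 2 * V / 2)))) μ :=
      hbint _ (hRcm.mul hdm) (E * 2) fun B => by
        rw [abs_mul]; exact mul_le_mul (hRcb B) (hdb B) (abs_nonneg _) (by positivity)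
    have hI2 : Integrable (fun B => Real.exp (-(θ ^ 2 * V / 2)) * RcN B) μ := (hbint _ hRcm E hRcb).const_mul _
    simp_rw [e1]
    rw [integral_add hI1 hI2, integral_const_mul]
    have eq : (∫ B, RcN B * (Real.exp (-(θ ^ 2 * AN B / 2)) - Real.exp (-(θ ^ 2 * V / 2))) ∂μ) +
        Real.exp (-(θ ^ 2 * V / 2)) * (∫ B, RcN B ∂μ) - Real.exp (-(θ ^ 2 * V / 2)) =
        (∫ B, RcN B * (Real.exp (-(θ ^ 2 * AN B / 2)) - Real.exp (-(θ ^ 2 * V / 2))) ∂μ) +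
          Real.exp (-(θ ^ 2 * V / 2)) * ((∫ B, RcN B ∂μ) - 1) := by ring
    rw [eq]
    refine (abs_add_le _ _).trans (add_le_add ?_ ?_)
    · calc |∫ B, RcN B * (Real.exp (-(θ ^ 2 * AN B / 2)) - Real.exp (-(θ ^ 2 * V / 2))) ∂μ|
          ≤ ∫ B, |RcN B * (Real.exp (-(θ ^ 2 * AN B / 2)) - Real.exp (-(θ ^ 2 * V / 2)))| ∂μ := abs_integral_le_integral_abs
        _ ≤ ∫ B, E * (Θ ^ 2 / 2) * |AN B - V| ∂μ := by
            refine integral_mono hI1.abs (hIAV.const_mul _) fun B => ?_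
            rw [abs_mul]
            calc |RcN B| * |Real.exp (-(θ ^ 2 * AN B / 2)) - Real.exp (-(θ ^ 2 * V / 2))| ≤ E * (Θ ^ 2 / 2 * |AN B - V|) :=
                  mul_le_mul (hRcb B) (hdexp B) (abs_nonneg _) (by positivity)
              _ = E * (Θ ^ 2 / 2) * |AN B - V| := by ring
        _ = E * (Θ ^ 2 / 2) * ∫ B, |AN B - V| ∂μ := integral_const_mul _ _
        _ ≤ E * (Θ ^ 2 / 2) * (cV * w) := mul_le_mul_of_nonneg_left hAV (by positivity)
    · rw [abs_mul, abs_of_pos (Real.exp_pos _)]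
      have h1 : Real.exp (-(θ ^ 2 * V / 2)) ≤ 1 := Real.exp_le_one_iff.mpr (by nlinarith [sq_nonneg θ])
      calc Real.exp (-(θ ^ 2 * V / 2)) * |(∫ B, RcN B ∂μ) - 1| ≤ 1 * (2 * Real.exp (Θ ^ 2 * Cq / 2) * CA * w) :=
            mul_le_mul h1 hRc (abs_nonneg _) zero_le_one
        _ = 2 * E * CA * w := by rw [hE]; ring
  have hsinM : |∫ B, Real.sin (θ * MN B) ∂μ| ≤ E * (Θ ^ 2 / 2) * (cV * w) + 2 * E * CA * w := by
    have e1 : ∀ B, Real.sin (θ * MN B) = RsN B * (Real.exp (-(θ ^ 2 * AN B / 2)) - Real.exp (-(θ ^ 2 * V / 2))) +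
        Real.exp (-(θ ^ 2 * V / 2)) * RsN B := by
      intro B
      simp only [hRsN]
      have : Real.exp (θ ^ 2 * AN B / 2) * Real.exp (-(θ ^ 2 * AN B / 2)) = 1 := by
        rw [← Real.exp_add, add_neg_cancel, Real.exp_zero]
      linear_combination (-(Real.sin (θ * MN B))) * this
    have hI1 : Integrable (fun B => RsN B * (Real.exp (-(θ ^ 2 * AN B / 2)) - Real.exp (-(θ ^ 2 * V / 2)))) μ :=
      hbint _ (hRsm.mul hdm) (E * 2) fun B => by
        rw [abs_mul]; exact mul_le_mul (hRsb B) (hdb B) (abs_nonneg _) (by positivity)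
    have hI2 : Integrable (fun B => Real.exp (-(θ ^ 2 * V / 2)) * RsN B) μ := (hbint _ hRsm E hRsb).const_mul _
    simp_rw [e1]
    rw [integral_add hI1 hI2, integral_const_mul]
    refine (abs_add_le _ _).trans (add_le_add ?_ ?_)
    · calc |∫ B, RsN B * (Real.exp (-(θ ^ 2 * AN B / 2)) - Real.exp (-(θ ^ 2 * V / 2))) ∂μ|
          ≤ ∫ B, |RsN B * (Real.exp (-(θ ^ 2 * AN B / 2)) - Real.exp (-(θ ^ 2 * V / 2)))| ∂μ := abs_integral_le_integral_abs
        _ ≤ ∫ B, E * (Θ ^ 2 / 2) * |AN B - V| ∂μ := by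
            refine integral_mono hI1.abs (hIAV.const_mul _) fun B => ?_
            rw [abs_mul]
            calc |RsN B| * |Real.exp (-(θ ^ 2 * AN B / 2)) - Real.exp (-(θ ^ 2 * V / 2))| ≤ E * (Θ ^ 2 / 2 * |AN B - V|) :=
                  mul_le_mul (hRsb B) (hdexp B) (abs_nonneg _) (by positivity)
              _ = E * (Θ ^ 2 / 2) * |AN B - V| := by ring
        _ = E * (Θ ^ 2 / 2) * ∫ B, |AN B - V| ∂μ := integral_const_mul _ _
        _ ≤ E * (Θ ^ 2 / 2) * (cV * w) := mul_le_mul_of_nonneg_left hAV (by positivity)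
    · rw [abs_mul, abs_of_pos (Real.exp_pos _)]
      have h1 : Real.exp (-(θ ^ 2 * V / 2)) ≤ 1 := Real.exp_le_one_iff.mpr (by nlinarith [sq_nonneg θ])
      calc Real.exp (-(θ ^ 2 * V / 2)) * |∫ B, RsN B ∂μ| ≤ 1 * (2 * Real.exp (Θ ^ 2 * Cq / 2) * CA * w) :=
            mul_le_mul h1 hRs (abs_nonneg _) zero_le_one
        _ = 2 * E * CA * w := by rw [hE]; ring
  -- (F7) replacing `X_N` by `a + M_N`
  have hIDN : Integrable (fun B => |DN B|) μ := (hIS2.const_mul (w * σ2 * (π / 2))).abs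
  have hDN : ∫ B, |DN B| ∂μ ≤ w * σ2 * (π / 2) * KK := by
    have e : ∀ B, |DN B| = w * σ2 * (π / 2) * |S2 B| := fun B => by
      simp only [hDN]; rw [abs_mul, abs_of_nonneg (by positivity : (0:ℝ) ≤ w * σ2 * (π / 2))]
    simp_rw [e]
    rw [integral_const_mul]
    exact mul_le_mul_of_nonneg_left hS2le' (by positivity)
  have hrepl : ∀ (φ : ℝ → ℝ), (∀ u v, |φ u - φ v| ≤ |u - v|) → (∀ u, |φ u| ≤ 1) → Continuous φ →
      |∫ B, φ (θ * X B N) ∂μ - ∫ B, φ (θ * (a + MN B)) ∂μ| ≤ Θ * (w * σ2 * (π / 2) * KK + C₃ * w) := by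
    intro φ hφL hφ1 hφc
    have hI1 : Integrable (fun B => φ (θ * X B N)) μ := hbint _ (hφc.measurable.comp (measurable_const.mul (hXm N))) 1 fun B => hφ1 _
    have hI2 : Integrable (fun B => φ (θ * (a + MN B))) μ :=
      hbint _ (hφc.measurable.comp (measurable_const.mul (measurable_const.add hMm))) 1 fun B => hφ1 _
    rw [← integral_sub hI1 hI2]
    have hpt : ∀ᵐ B ∂μ, |φ (θ * X B N) - φ (θ * (a + MN B))| ≤ Θ * (|DN B| + C₃ * w) := by
      filter_upwards [hF1] with B hB
      refine (hφL _ _).trans ?_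
      rw [← mul_sub, abs_mul]
      refine mul_le_mul hθ ?_ (abs_nonneg _) hΘ
      have e : θ * 0 + (X B N - (a + MN B)) = (X B N - a - MN B - DN B) + DN B := by ring
      rw [show X B N - (a + MN B) = θ * 0 + (X B N - (a + MN B)) by ring, e]
      refine (abs_add_le _ _).trans ?_
      linarith only [hB]
    calc |∫ B, (φ (θ * X B N) - φ (θ * (a + MN B))) ∂μ| ≤ ∫ B, |φ (θ * X B N) - φ (θ * (a + MN B))| ∂μ :=
          abs_integral_le_integral_abs
      _ ≤ ∫ B, Θ * (|DN B| + C₃ * w) ∂μ := integral_mono_ae (hI1.sub hI2).abs ((hIDN.add (integrable_const _)).const_mul Θ) hpt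
      _ = Θ * (∫ B, |DN B| ∂μ + C₃ * w) := by
          rw [integral_const_mul, integral_add hIDN (integrable_const _), integral_const, probReal_univ, one_smul]
      _ ≤ Θ * (w * σ2 * (π / 2) * KK + C₃ * w) := mul_le_mul_of_nonneg_left (by linarith only [hDN]) hΘ
  -- (F8) integrals of `cos θ(a + M_N)`, `sin θ(a + M_N)`
  have hIcM : Integrable (fun B => Real.cos (θ * MN B)) μ :=
    hbint _ (Real.measurable_cos.comp (measurable_const.mul hMm)) 1 fun B => Real.abs_cos_le_one _
  have hIsM : Integrable (fun B => Real.sin (θ * MN B)) μ :=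
    hbint _ (Real.measurable_sin.comp (measurable_const.mul hMm)) 1 fun B => Real.abs_sin_le_one _
  have hcos_aM : ∫ B, Real.cos (θ * (a + MN B)) ∂μ = Real.cos (θ * a) * ∫ B, Real.cos (θ * MN B) ∂μ -
      Real.sin (θ * a) * ∫ B, Real.sin (θ * MN B) ∂μ := by
    have e : ∀ B, Real.cos (θ * (a + MN B)) = Real.cos (θ * a) * Real.cos (θ * MN B) - Real.sin (θ * a) * Real.sin (θ * MN B) := by
      intro B; rw [mul_add, Real.cos_add]
    simp_rw [e]
    rw [integral_sub (hIcM.const_mul _) (hIsM.const_mul _), integral_const_mul, integral_const_mul]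
  have hsin_aM : ∫ B, Real.sin (θ * (a + MN B)) ∂μ = Real.sin (θ * a) * ∫ B, Real.cos (θ * MN B) ∂μ +
      Real.cos (θ * a) * ∫ B, Real.sin (θ * MN B) ∂μ := by
    have e : ∀ B, Real.sin (θ * (a + MN B)) = Real.sin (θ * a) * Real.cos (θ * MN B) + Real.cos (θ * a) * Real.sin (θ * MN B) := by
      intro B; rw [mul_add, Real.sin_add]
    simp_rw [e]
    rw [integral_add (hIcM.const_mul _) (hIsM.const_mul _), integral_const_mul, integral_const_mul]
  -- constants bookkeeping
  set T1 : ℝ := Θ * (w * σ2 * (π / 2) * KK + C₃ * w) with hT1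
  set T2 : ℝ := E * (Θ ^ 2 / 2) * (cV * w) + 2 * E * CA * w with hT2
  have hT20 : 0 ≤ T2 := by positivity
  have hCw : C * w = T1 + 2 * T2 := by rw [hC, hT1, hT2]; ring
  have hgoalX : ∀ φ : ℝ → ℝ, (∫ B, φ (θ * ahPhase w x (finExt B) N) ∂μ) = ∫ B, φ (θ * X B N) ∂μ := fun φ => rfl
  have hVeq : -(θ ^ 2 * (3 / 8 * bM2 ρB * w ^ 2 * N) / 2) = -(θ ^ 2 * V / 2) := by rw [hV]
  constructor
  · rw [hgoalX Real.cos, hVeq, hCw]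
    have h1 := hrepl Real.cos abs_cos_sub_cos_le' Real.abs_cos_le_one Real.continuous_cos
    set Ic := ∫ B, Real.cos (θ * MN B) ∂μ with hIc
    set Is := ∫ B, Real.sin (θ * MN B) ∂μ with hIs
    have e : (∫ B, Real.cos (θ * X B N) ∂μ) - Real.exp (-(θ ^ 2 * V / 2)) * Real.cos (θ * a) =
        ((∫ B, Real.cos (θ * X B N) ∂μ) - ∫ B, Real.cos (θ * (a + MN B)) ∂μ) +
          (Real.cos (θ * a) * (Ic - Real.exp (-(θ ^ 2 * V / 2))) - Real.sin (θ * a) * Is) := by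
      rw [hcos_aM]; ring
    rw [e]
    refine (abs_add_le _ _).trans (add_le_add h1 ?_)
    refine (abs_sub _ _).trans ?_
    rw [abs_mul, abs_mul]
    have h2 := mul_le_mul (Real.abs_cos_le_one (θ * a)) hcosM (abs_nonneg _) zero_le_one
    have h3 := mul_le_mul (Real.abs_sin_le_one (θ * a)) hsinM (abs_nonneg _) zero_le_one
    linarith only [h2, h3]
  · rw [hgoalX Real.sin, hVeq, hCw]
    have h1 := hrepl Real.sin abs_sin_sub_sin_le' Real.abs_sin_le_one Real.continuous_sin
    set Ic := ∫ B, Real.cos (θ * MN B) ∂μ with hIc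
    set Is := ∫ B, Real.sin (θ * MN B) ∂μ with hIs
    have e : (∫ B, Real.sin (θ * X B N) ∂μ) - Real.exp (-(θ ^ 2 * V / 2)) * Real.sin (θ * a) =
        ((∫ B, Real.sin (θ * X B N) ∂μ) - ∫ B, Real.sin (θ * (a + MN B)) ∂μ) +
          (Real.sin (θ * a) * (Ic - Real.exp (-(θ ^ 2 * V / 2))) + Real.cos (θ * a) * Is) := by
      rw [hsin_aM]; ring
    rw [e]
    refine (abs_add_le _ _).trans (add_le_add h1 ?_)
    refine (abs_add_le _ _).trans ?_
    rw [abs_mul, abs_mul]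
    have h2 := mul_le_mul (Real.abs_sin_le_one (θ * a)) hcosM (abs_nonneg _) zero_le_one
    have h3 := mul_le_mul (Real.abs_cos_le_one (θ * a)) hsinM (abs_nonneg _) zero_le_one
    linarith only [h2, h3]

end Literature.Barriers.AtomisticToContinuum.HeatConduction

end
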